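import Literature.MathematicalPhysics.QuantumFieldTheory.Balaban1983to89.T4IndicatorShell

/-!
# `Balaban1983to89.T4ShellMeasure` — node U5b, cell input NE7c, SHELL-MEASURE ROUTE: the single-run shell-weight bound
`T4IndicatorShell.ShellWeightBound` from ANTI-CONCENTRATION of the tested background variables at their thresholds
(cell `pub-balaban`, T4-DAG v15 §6 row NE7c, fan-out seat `b2b-balaban-t4-ne7c-p1`; kernel bookkeeping, Mathlib +
`T4IndicatorShell` only; companion record `t4/T4-EST-NE7c-P1.md`)

HONEST FRAMING (cell `pub-balaban`, T4-DAG PAGE 1).  The cell's T4 target is the existence AND uniqueness of the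
continuum limit of Bałaban's unit-scale averaged loop expectations on a FINITE torus (rung (B)+1 scoping) — strictly
beyond ultraviolet stability ([Balaban1989LargeFieldII] Thm 1 p. 355); it is NOT infinite volume, NOT the Yang–Mills
mass gap and NOT the Clay problem.  NOTHING of the run-A/run-B comparison is printed: the manuscripts construct ONE
run.  This module is the kernel part of ONE of the (at least two) competing routes to the cell-internal input NE7c =
`T4IndicatorShell.ShellWeightBound` (the total weight of the terms of ONE run carrying a shell piece — a
background-mediated tested variable within relative distance `ρ_j` of its threshold — is a summable fraction `Wsh K`
of the run's total weight): the SHELL-MEASURE route, which bounds the weight of a threshold shell by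
ANTI-CONCENTRATION of the tested variable's law at the scale of the shell (no large-field small factor, no lowered
threshold, no survival-rate condition — those belong to the sibling LOWERED-THRESHOLD route, record
`t4/T4-EST-U5bE2.md` §3, and are not touched here).  Value = the route made kernel-precise and its FIRST NON-PRINTED
STEP typed: (§1) three elementary one-dimensional anti-concentration devices — (a) QUASI-INVARIANCE of an interval
weight under downward translation in the log-coordinate of the tested variable (= dilation of the variable towards
small fields) with exponential cost `e^{B r}` gives SHELL ≤ `(e^{B r₀}/m)`·CORE for `m` disjoint translates inside the
window `r₀` (`shell_le_core_of_quasiInvariant`; optimum `r₀ = 1/B`, constant `≈ e·B·ρ`); (b) a uniform DENSITY bound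
for a real law (e.g. the Gaussian one, `gaussianReal_Icc_le`: `N(m, v)[a, b] ≤ (b − a)/√(2πv)` uniformly in the mean —
the small-field Gaussian control made kernel) transported through a TRANSVERSAL coordinate along which the tested
variable has slope `≥ κ` (`preimage_window_subset_Icc`, `measure_preimage_window_le`: shell mass `≤ 2·P·δ/κ`);
(c) THRESHOLD AVERAGING (`exists_threshold_shell_le`: among `n` disjoint candidate shells inside the printed threshold
slack one carries at most `1/n` of the total weight — no smoothness at all, but it needs the freedom to choose the
threshold per run); (§2) the SLOT LEDGER: if every term's shell part is covered by per-slot shell pieces and every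
slot's pieces weigh at most `c_s ×` the run's total weight, the shell part weighs at most `(Σ_s c_s) ×` the total
(`shell_sum_le_of_slots`), and `Σ_s c_s = Σ_j ν_j·c_j` by level (`sum_slots_eq_sum_levels`); (§3) the ARITHMETIC: with
slot intensities `ν_j ≤ ν̄`, anti-concentration constants `D_j ≤ D̄` and the RATE form of the two runs' sup-closeness
`ρ_j ≤ c₁ϑ^j` (`ϑ < 1`, node U1b species NE3) on a bounded window of live levels `K − N₁ ≤ j ≤ K`, the per-run bound is
`≤ C·ϑ^K` (`levelSum_le_geometric`), hence summable and eventually below any `ε` (`summable_of_le_geometric`,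
`eventually_lt_of_le_geometric`); (§4) the CONSTRUCTOR `shellWeightBound_of_slotLedger` delivering
`T4IndicatorShell.ShellWeightBound l₀ T A B shA shB Wsh` with `Wsh K = ω^A_K + ω^B_K` from the per-run slot ledgers;
(§5) the FIRST NON-PRINTED STEP of the route as a NAMED HYPOTHESIS SHAPE, `SlotAntiConcentration μ u θ ρ D` (the
measure of the shell `{θ(1 − ρ) ≤ u < θ}` of ONE background-mediated slot under the run's positive measure is at most
`D·ρ ×` the total mass), with its reduction to (b) in the exactly transversal case (`slotAntiConcentration_of_transversal`); (§6) the
CLOSURE BY THRESHOLD AVERAGING (grounding (δ), the route's recommended member): candidate shells `[θ(1−ρ)^{i+1}, θ(1−ρ)^i)`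
are disjoint and inside the slack window `[θ(1 − nρ), θ)` (`candShell_disjoint`, `candShell_subset_window`), some
candidate threshold serves BOTH runs at once with shell fraction `≤ 2ν/n ≈ 2νρ/β′` (`exists_common_threshold`), and one
choice per `K` serves all sources `|t| ≤ l₀` (`ratio_transfer_of_tilt`) — no smoothness of any law is needed, only the
located threshold-robustness of the single-run bounds (L1) and the density-preserving re-representation (L2);
(§7) the JOINT THRESHOLD CHOICE over the whole live window (cross-read advisory A2 on v2 of this module: for
history-dependent slot families the level-`j` candidate weights depend on the thresholds in force at the OTHER live
levels, so §6 may not be iterated level by level): averaging over the product GRID of candidate assignments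
(`exists_joint_choice_of_fibres`, `exists_joint_common_threshold`) one assignment serves all live levels and both
runs at once with level-summed shell fraction `≤ Σ_j 2ν_j/n_j`, `n_j = ⌊β′/ρ_j⌋₊` (`candidateCount_spec`), hence
`≤ C·ϑ^K` per run (`exists_threshold_choice_function`), and the REALIZED LEDGERS of the two runs written with the
chosen thresholds (`SlotLedger.of_realized`, `shellWeightBound_of_realized`) deliver `ShellWeightBound` with
`Wsh K ≤ 2e^{2a}Cϑ^K` — grounding (δ) is thereby kernel-complete modulo the located inputs (L1), (L2) and the bounded
live window; (§8, v4) the LIVE COMMON THRESHOLD FACTOR and the CASCADE COUNT: under the decision-tree reading (R) of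
the expansion (sharp decompositions of unity inserted conditionally on the older outcomes, B15 pp. 181–183) every
booked test is a monotone threshold test with a FLIP INDEX along the candidate factors `λ_i = (1 − ρ⋆)^i`
(`exists_flipIndex_threshold`), it can carry shell weight at candidate `i` only when it flips there
(`flipIndex_eq_of_mem_candShell`, `flipIndex_eq_of_mem_aboveShell`), and through `S` live stages with `≤ ν_σ` booked
tests each the flips number `≤ 2(∏_σ(ν_σ + 1) − 1)` in total over ALL candidates, pointwise in the configuration
(`sum_hits₂_livePaths_le`); integrating (`sum_lintegral_le_of_pointwise`) and pigeonholing from the two runs' totals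
(`exists_common_index_of_totals`, `exists_liveFactor_choice_function`) ONE common factor per `K` serves both runs,
and `shellWeightBound_of_liveFactor` delivers `ShellWeightBound` BY NAME — a member needing of the expansion only (R)
and the window (W1) (no own-coordinate disjointness (L2a)), whose threshold-robustness input shrinks to ONE common
lowering of all live thresholds (L1-step), the only printed comparison losing room being the large-field suppression
exponents (factor `λ² ≥ (1 − β′)²`, printed margin B16 p. 383); §8 also discharges §7's hypotheses `hA`/`hB` under
(R) when §7's coordinates are the live STAGES (`tree_ownShell_sum_le`, `ownShell_hyp_of_tree`) and orders §7's grid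
by nested stage windows (`stage_candShell_subset_window`), so that member (δ) survives with §7's constants and the
robustness input (L1-ordered).
NOT summit progress, NOT a proof of NE7c, NOT a statement about Bałaban's densities: every `def … : Prop` below is a
hypothesis SHAPE; every theorem is finite-sum algebra, elementary real analysis or a one-line Mathlib Gaussian fact
([folklore]).

CITATION HEADER (lean-in-tree rule 2026-08-18).  This seat (`b2b-balaban-t4-ne7c-p1`) read the RENDERS
`b2b-balaban-ref1/pages/1988-cmp119-convergent-renormalization/1988-cmp119-convergent-renormalization-p015-x2.png` and
`-p016-x2.png` (journal pp. 257, 258 of T. Bałaban, *Convergent renormalization expansions for lattice gauge theories*,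
Commun. Math. Phys. **119** (1988) 243–285 [Balaban1988Convergent], cell paper B14; PDF page = journal page − 242),
`…/1989-cmp122-large-field-I/1989-cmp122-large-field-I-p007-x2.png` and `-p019-x2.png` (journal pp. 181, 193 of
T. Bałaban, *Large field renormalization. I. The basic step of the ℝ operation*, Commun. Math. Phys. **122** (1989)
175–202 [Balaban1989LargeFieldI], cell paper B15; PDF page = journal page − 174) and
`…/1987-cmp109-rg-I-small-field/1987-cmp109-rg-I-small-field-p008-x2.png`, `-p016-x2.png` (journal pp. 256, 264 of
T. Bałaban, *Renormalization group approach to lattice gauge field theories. I*, Commun. Math. Phys. **109** (1987)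
249–301 [Balaban1987RG1], cell paper B12; PDF page = journal page − 248) as images, and quotes VERBATIM:
* B14 p. 257: *"χ_k(Ω_k) = ∏_{□⊂Ω_k} χ({sup_{p⊂□∼} |U_{k,□}(V_k, ∂p) − 1| < ε_kη²}) , (2.17) where the cubes □ belong to
  the partition of the lattice T_η into cubes of the size LM₂R_k."* (ONE tested variable `u_□ = sup_{p⊂□∼}|U_{k,□}(V_k,∂p)
  − 1|` per cube = one SLOT, threshold `θ_k = ε_kη²`); *"ρ_k(V_k) = Σ_{{Ω_j},{Λ_j}} χ_k(Ω_k)T_k({Ω_j},{Λ_j}) exp A_k(1/g_k²,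
  U_k) , (2.18)"* (the run's density is a sum of NONNEGATIVE terms: indicator × positive operation × exponential).
* B14 p. 258: *"T^{(j)}(Z_{j+1}∩X) = ∫dV_j|… δ(V̄_jV_{j+1}^{−1})ζ(Ω^c_{j+1}) · ∫dA_j|… χ(Z_{j+1}∩Ω_{j+1}∩X) exp[−½⟨A_j,
  C*Δ^{(j)}CA_j⟩ + ½⟨A_j, C*Δ^{(j)}CC^{(j)}(Λ_{j+1})C*Δ^{(j)}CA_j⟩] . (2.21)"* (the one-step operations are GAUSSIAN
  fluctuation integrals restricted by characteristic functions — the "small-field Gaussian control" this route invokes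
  for the law of a tested variable along a transversal fibre); *"A_k(1/g_k², U_k) = −A(1/g_k², U_k) + 𝐄_k(U_k) + 𝐑_k(U_k)
  + 𝐁_k(U_k, A) − E_k . (2.23)"*.
* B12 p. 256: *"A_k(g_k, V) = A_k(g_k, U_k(V)) = −(1/g_k²) A^η(U_k(V)) + 𝐄_k(U_k(V)) . (0.22)"* (the weight depends on `V`
  through the background `U_k(V)`; its logarithm is `1/g_k²` times a smooth functional — the source of the dilation
  cost `B ∼ (LM₂R_k)⁴/g_k² × (field strength)² ≲ (LM₂R_k)⁴ε_k²/g_k²` on the small-field set in device (a)).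
* B15 p. 181: *"χ_k^{(0)} = χ({|U^{(0)}_{k,Z}(∂p) − 1| < (1 − β½)ε_h(L^{k−h}η)² for p ∈ Ω_h∖Ω_{h+1}}). (1.22)"* and the
  ladder (1.23) with thresholds `(1 − β(1 − 2^{−(j−h+1)}))ε_h(L^{k−h}η)²`; *"for these we change the regularity conditions
  by a factor, which is a power of some number, the power being proportional to a number of overlapping regions."* (the
  printed thresholds come with SLACK: the inductive bounds are insensitive to the precise threshold inside a factor-2
  ladder — the located, not printed, input of device (c)).
* B15 p. 193: *"Thus 1 − χ_{k,Λ} is a large field function, and we exclude from Z the components with this function."*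
  (the printed mechanism is a LARGE-FIELD SMALL FACTOR at a LOWERED threshold — the sibling route; the present route
  does not use it).
(v4, §8) This seat further read the renders `…/1989-cmp122-large-field-I/1989-cmp122-large-field-I-p008-x2.png`,
`-p009-x2.png`, `-p019-x2.png`, `-p020-x2.png` (journal pp. 182, 183, 193, 194 of [Balaban1989LargeFieldI]),
`…/1988-cmp119-convergent-renormalization/1988-cmp119-convergent-renormalization-p015-x2.png`, `-p016-x2.png` again
(journal pp. 257, 258 of [Balaban1988Convergent]) and
`…/1989-cmp122-large-field-II/1989-cmp122-large-field-II-p029-x2.png` (journal p. 383 of T. Bałaban, *Large field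
renormalization. II. Localization, exponentiation, and bounds for the ℝ operation*, Commun. Math. Phys. **122**
(1989) 355–392 [Balaban1989LargeFieldII], cell paper B16; PDF page = journal page − 354) as images, confirmed the
sentences against the held text layers (`paper:balaban1989-cmp122-large-field-i` pp. 7–9, 19–20;
`paper:balaban1988-cmp119-convergent-renormalization` pp. 15–16; `paper:balaban1989-cmp122-large-field-ii` p. 29),
and quotes VERBATIM:
* B14 p. 257: *"where the summation is over the admissible sequences of domains."*; pp. 257–258: *"Basically this
  operation is a composition of integrations restricted to large field regions in successive scales, and
  multiplications by characteristic functions, δ-functions defining renormalization transformations, and gauge fixing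
  expressions."* (the terms of (2.18) are indexed by sequences of domains decided step after step: a decision tree).
* B15 p. 181: *"More precisely, we introduce this decomposition in each component of Z separately."*; p. 182: *"In
  this integral we introduce the decomposition of unity 1 = χ_k^{(n+1)} + (1 − χ_k^{(n+1)}) for each component of Z,
  and we exclude from Z the components with the large field functions 1 − χ_k^{(n+1)}. The function χ_k^{(n+1)} does
  not depend on integration variables"*; p. 182: *"We choose the number β satisfying 0 < β ≤ 1/2, but not too small,
  e.g., we can take β = 1/2."*; p. 183: *"Let us notice that all the characteristic functions introduced above depend
  on the field variables localized in the corresponding components of the large field region Z_k. This is an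
  important part of the inductive assumption for the effective density, more precisely for the operation 𝕋_k(Z_k)."*
  and *"Now we will prove that the restrictions introduced by the new characteristic functions imply that the
  functions (1.3), (1.4), (1.5), (1.7), (1.8), χ_k^{(n)} are equal to 1."* (sharp decompositions of unity inserted
  component by component, conditionally on the regions decided before; new conditions imply the inherited ones).
* B15 p. 193: *"Now we define the next operation, which changes the density. The equality sign is replaced by the
  equivalence sign, the equivalence means that both sides have equal integrals over the space of fields"* (what is
  compared across `K` are integrals).
* B16 p. 383: *"This is the largest factor among all the small factors we have obtained from the large field
  characteristic functions in the preparatory steps. We assume that 2p₁ − (d + 5)r₀ > p₀, and we estimate the factors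
  by exp(−p₀(g_j))."* (the printed MARGIN in the large-field suppression exponents: a strict inequality between powers
  of `log g_j^{−2}`, which absorbs any constant factor `λ² > 0` in the exponent for `g_j` small — the one place where a
  common lowering of the live thresholds costs room).
NOT PRINTED anywhere in B12/B14/B15/B16 (searched as renders and in the cell's cross-read records `t4/T4-XREAD-U5X15.md`,
`t4/T4-EST-U5bE2.md`): any statement about the MASS of a threshold shell `{(1 − ρ)θ ≤ u < θ}` of a background-mediated
tested variable, any density / anti-concentration bound for the law of `u_□`, any transversality of the minimiser's
plaquette variables with respect to the integration variables.  These are exactly the hypotheses typed in §5.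
Literature presearch (both corpora, 2026-08-19): anti-concentration of the MAXIMUM of (correlated) Gaussian variables
treated as ONE variable — [corpus:paper:arxiv-1301.4807 p.7 Thm 3] (Chernozhukov–Chetverikov–Kato, *Comparison and
anti-concentration bounds for maxima of Gaussian random vectors*, Probab. Theory Relat. Fields **162** (2015) 47–70,
doi:10.1007/s00440-014-0565-9, Thm 3 (i): `sup_x P(|max_j X_j − x| ≤ ε) ≤ 4ε(a_p + 1)/σ`, `a_p = E max_j X_j/σ_j ≤
√(2 log p)`) — the dimension enters only through `√(log p)`, which is why the route treats `sup_{p⊂□∼}` as one variable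
and never unions over plaquettes; no hits for "anti-concentration|Carbery-Wright" joined to renormalization thresholds in
galaxy (`--star all`) or the held corpus (fts+vec).

(value: the NE7c shell-measure route typed end-to-end — three anti-concentration devices, the slot ledger, the
geometric arithmetic and the constructor of `ShellWeightBound` are kernel facts; the single non-printed input is the
named shape `SlotAntiConcentration` with its groundings and costs in the record; orientation for the t4-carver's choice
between the NE7c routes, not summit progress.)
-/

namespace Literature.MathematicalPhysics.QuantumFieldTheory.Balaban1983to89.T4ShellMeasure

open Finset MeasureTheory ProbabilityTheory
open scoped NNReal ENNReal

/-! ## §1(a) Quasi-invariance of an interval weight under downward translation ⇒ shell ≤ const · core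

Dictionary.  `x = log u` is the log-coordinate of ONE tested variable `u = u_□` (B14 (2.17)); `w a b ≥ 0` is the weight
(under the run's positive measure at fixed source `t`, all other variables integrated out) of the window `a ≤ x < b`;
`b = log θ` is the log-threshold; the shell of relative width `ρ` is the window `[b − ℓ, b)` with `ℓ = −log(1 − ρ)`;
translation `x ↦ x − r` is the dilation `u ↦ e^{−r}u` towards small fields, and `QuasiInvariant w B r₀` says that
pushing a window down by `r ≤ r₀` loses at most the factor `e^{−B r}` of its weight (`B` = action derivative + Jacobian
along the dilation; NOT PRINTED — see §5 and the record for the groundings (α) gauge-fixed link dilation, (β)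
background-coordinate dilation). -/

/-- An INTERVAL WEIGHT: `w a b` = weight of the half-open window `[a, b)`, additive over adjacent windows and
nonnegative. [folklore] -/
structure IntervalWeight (w : ℝ → ℝ → ℝ) : Prop where
  /-- additivity over adjacent windows -/
  add : ∀ a b c, a ≤ b → b ≤ c → w a c = w a b + w b c
  /-- nonnegativity -/
  nonneg : ∀ a b, 0 ≤ w a b

/-- DOWNWARD QUASI-INVARIANCE with exponential cost: translating a window down by `r ∈ [0, r₀]` keeps at least the
fraction `e^{−B r}` of its weight.  (Hypothesis shape, NOT PRINTED.) [folklore] -/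
def QuasiInvariant (w : ℝ → ℝ → ℝ) (B r₀ : ℝ) : Prop :=
  ∀ a b r, a ≤ b → 0 ≤ r → r ≤ r₀ → w a b ≤ Real.exp (B * r) * w (a - r) (b - r)

namespace IntervalWeight

variable {w : ℝ → ℝ → ℝ}

/-- an empty window weighs nothing. [folklore] -/
theorem self_eq_zero (hw : IntervalWeight w) (a : ℝ) : w a a = 0 := by
  have h := hw.add a a a le_rfl le_rfl
  linarith

/-- monotonicity in the left end-point. [folklore] -/
theorem mono_left (hw : IntervalWeight w) {a a' b : ℝ} (h : a ≤ a') (h' : a' ≤ b) : w a' b ≤ w a b := by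
  rw [hw.add a a' b h h']
  linarith [hw.nonneg a a']

/-- telescoping: the window `[b − (m+1)ℓ, b − ℓ)` is the sum of the `m` translates `[b − (i+2)ℓ, b − (i+1)ℓ)`,
`i < m`, of the shell `[b − ℓ, b)`. [folklore] -/
theorem window_eq_sum_translates (hw : IntervalWeight w) (b ℓ : ℝ) (hℓ : 0 ≤ ℓ) (m : ℕ) :
    w (b - (m + 1) * ℓ) (b - ℓ) = ∑ i ∈ range m, w (b - (i + 2) * ℓ) (b - (i + 1) * ℓ) := by
  induction m with
  | zero => simp [hw.self_eq_zero]
  | succ m ih =>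
    rw [sum_range_succ, ← ih]
    have h1 : b - ((m : ℝ) + 1 + 1) * ℓ ≤ b - ((m : ℝ) + 1) * ℓ := by nlinarith
    have h2 : b - ((m : ℝ) + 1) * ℓ ≤ b - ℓ := by nlinarith
    rw [Nat.cast_succ, hw.add _ _ _ h1 h2]
    ring_nf

end IntervalWeight

/-- ONE TRANSLATE: under quasi-invariance the shell `[b − ℓ, b)` weighs at most `e^{B r₀}` times its `i`-th downward
translate, as long as `i·ℓ ≤ r₀`. [folklore] -/
theorem shell_le_exp_mul_translate {w : ℝ → ℝ → ℝ} {B r₀ : ℝ} (hw : IntervalWeight w) (hq : QuasiInvariant w B r₀)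
    (hB : 0 ≤ B) {b ℓ : ℝ} (hℓ : 0 ≤ ℓ) {i : ℕ} (hi : (i : ℝ) * ℓ ≤ r₀) :
    w (b - ℓ) b ≤ Real.exp (B * r₀) * w (b - (i + 1) * ℓ) (b - i * ℓ) := by
  have hr : 0 ≤ (i : ℝ) * ℓ := by positivity
  have h := hq (b - ℓ) b ((i : ℝ) * ℓ) (by linarith) hr hi
  have h1 : b - ℓ - (i : ℝ) * ℓ = b - (i + 1) * ℓ := by ring
  rw [h1] at h
  refine h.trans (mul_le_mul_of_nonneg_right ?_ (hw.nonneg _ _))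
  exact Real.exp_le_exp.mpr (mul_le_mul_of_nonneg_left hi hB)

/-- **SHELL ≤ (e^{B r₀}/m) · WINDOW BELOW THE SHELL** (device (a)).  Under downward quasi-invariance with cost rate `B`
on translations `≤ r₀`, `m` times the weight of the shell `[b − ℓ, b)` is at most `e^{B r₀}` times the weight of the
window `[b − (m+1)ℓ, b − ℓ)` just below it, provided `m·ℓ ≤ r₀`.  With `ℓ = −log(1 − ρ) ≈ ρ`, `r₀ = 1/B` and
`m ≈ r₀/ℓ`: shell `≲ e·B·ρ ×` core. [folklore] -/
theorem shell_le_core_of_quasiInvariant {w : ℝ → ℝ → ℝ} {B r₀ : ℝ} (hw : IntervalWeight w)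
    (hq : QuasiInvariant w B r₀) (hB : 0 ≤ B) {b ℓ : ℝ} (hℓ : 0 ≤ ℓ) {m : ℕ} (hm : (m : ℝ) * ℓ ≤ r₀) :
    (m : ℝ) * w (b - ℓ) b ≤ Real.exp (B * r₀) * w (b - (m + 1) * ℓ) (b - ℓ) := by
  rw [hw.window_eq_sum_translates b ℓ hℓ m, mul_sum]
  have : (m : ℝ) * w (b - ℓ) b = ∑ i ∈ range m, w (b - ℓ) b := by simp
  rw [this]
  refine sum_le_sum fun i hi => ?_
  have him : (i : ℝ) + 1 ≤ m := by exact_mod_cast Nat.succ_le_of_lt (mem_range.mp hi)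
  have hi' : ((i + 1 : ℕ) : ℝ) * ℓ ≤ r₀ := by
    refine le_trans ?_ hm
    push_cast
    exact mul_le_mul_of_nonneg_right him hℓ
  have h := shell_le_exp_mul_translate hw hq hB (b := b) hℓ hi'
  push_cast at h
  have e1 : b - ((i : ℝ) + 1 + 1) * ℓ = b - (i + 2) * ℓ := by ring
  rw [e1] at h
  exact h

/-- The same with an arbitrary CORE window `[a, b − ℓ)` containing the `m` translates (`a ≤ b − (m+1)ℓ`):
`m · shell ≤ e^{B r₀} · core`. [folklore] -/
theorem shell_le_core_of_quasiInvariant' {w : ℝ → ℝ → ℝ} {B r₀ : ℝ} (hw : IntervalWeight w)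
    (hq : QuasiInvariant w B r₀) (hB : 0 ≤ B) {a b ℓ : ℝ} (hℓ : 0 ≤ ℓ) {m : ℕ} (hm : (m : ℝ) * ℓ ≤ r₀)
    (ha : a ≤ b - (m + 1) * ℓ) :
    (m : ℝ) * w (b - ℓ) b ≤ Real.exp (B * r₀) * w a (b - ℓ) := by
  refine (shell_le_core_of_quasiInvariant hw hq hB hℓ hm).trans ?_
  refine mul_le_mul_of_nonneg_left (hw.mono_left ha ?_) (Real.exp_pos _).le
  nlinarith

/-- Choosing the number of translates: if the shell is thin, `4ℓ ≤ r₀`, there is an `m` with `m·ℓ ≤ (m+1)·ℓ ≤ r₀`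
and `r₀/(2ℓ) ≤ m`, so that device (a) gives shell `≤ (2ℓ·e^{B r₀}/r₀) ×` core — LINEAR in the shell width.
[folklore] -/
theorem exists_translate_count {ℓ r₀ : ℝ} (hℓ : 0 < ℓ) (h4 : 4 * ℓ ≤ r₀) :
    ∃ m : ℕ, ((m : ℝ) + 1) * ℓ ≤ r₀ ∧ r₀ / (2 * ℓ) ≤ m := by
  obtain ⟨n, hn⟩ : ∃ n : ℕ, n = ⌊r₀ / ℓ⌋₊ := ⟨_, rfl⟩
  have hq4 : 4 ≤ r₀ / ℓ := by rw [le_div_iff₀ hℓ]; linarith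
  have hq0 : 0 ≤ r₀ / ℓ := by linarith
  have hnle : (n : ℝ) ≤ r₀ / ℓ := by rw [hn]; exact Nat.floor_le hq0
  have hnlt : r₀ / ℓ < n + 1 := by rw [hn]; exact Nat.lt_floor_add_one _
  have hn1 : 1 ≤ n := by
    have : (3 : ℝ) < n := by linarith
    exact_mod_cast (show (1 : ℝ) ≤ n by linarith)
  refine ⟨n - 1, ?_, ?_⟩
  · have : ((n - 1 : ℕ) : ℝ) + 1 = n := by rw [Nat.cast_sub hn1]; push_cast; ring
    rw [this]
    rwa [le_div_iff₀ hℓ] at hnle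
  · rw [Nat.cast_sub hn1, Nat.cast_one, div_le_iff₀ (by positivity)]
    have h1 : r₀ / ℓ * ℓ = r₀ := div_mul_cancel₀ _ hℓ.ne'
    nlinarith

/-- **LINEAR-IN-WIDTH FORM of device (a).**  For a thin shell (`0 < ℓ`, `4ℓ ≤ r₀`) under quasi-invariance:
shell `≤ (2 e^{B r₀}/r₀)·ℓ ×` (window `[a, b − ℓ)`) for every `a ≤ b − r₀`. [folklore] -/
theorem shell_le_linear_of_quasiInvariant {w : ℝ → ℝ → ℝ} {B r₀ : ℝ} (hw : IntervalWeight w)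
    (hq : QuasiInvariant w B r₀) (hB : 0 ≤ B) {a b ℓ : ℝ} (hℓ : 0 < ℓ) (h4 : 4 * ℓ ≤ r₀) (ha : a ≤ b - r₀) :
    w (b - ℓ) b ≤ (2 * Real.exp (B * r₀) / r₀) * ℓ * w a (b - ℓ) := by
  obtain ⟨m, hm1, hm2⟩ := exists_translate_count hℓ h4
  have hr₀ : 0 < r₀ := by linarith
  have hmpos : (0 : ℝ) < m := lt_of_lt_of_le (by positivity) hm2
  have hm0 : (m : ℝ) * ℓ ≤ r₀ := by nlinarith
  have ha' : a ≤ b - (m + 1) * ℓ := by linarith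
  have h := shell_le_core_of_quasiInvariant' hw hq hB hℓ.le hm0 ha'
  -- divide by m and use 1/m ≤ 2ℓ/r₀
  have hcore : 0 ≤ w a (b - ℓ) := hw.nonneg _ _
  have hinv : 1 / (m : ℝ) ≤ 2 * ℓ / r₀ := by
    rw [div_le_div_iff₀ hmpos hr₀]; rw [div_le_iff₀ (by positivity)] at hm2; linarith
  calc w (b - ℓ) b = (1 / (m : ℝ)) * ((m : ℝ) * w (b - ℓ) b) := by field_simp
    _ ≤ (2 * ℓ / r₀) * (Real.exp (B * r₀) * w a (b - ℓ)) :=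
        mul_le_mul hinv h (mul_nonneg hmpos.le (hw.nonneg _ _)) (by positivity)
    _ = (2 * Real.exp (B * r₀) / r₀) * ℓ * w a (b - ℓ) := by ring

/-! ## §1(b) Uniform density along a transversal coordinate (small-field Gaussian control made kernel)

Dictionary.  `ξ` is a real coordinate along a fibre of configuration space TRANSVERSAL to the level sets of the tested
variable near its threshold; `φ ξ` is the tested variable along the fibre, with slope `≥ κ > 0`; `μ` is the conditional
law of `ξ` on the fibre, with density `≤ P` (for the Gaussian fluctuation measure of B14 (2.21): `P = 1/√(2π v)` with
`v` the conditional variance of `ξ`, `gaussianReal_Icc_le`, uniformly in the conditional mean; a bounded non-Gaussian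
factor `e^{±B₁}` multiplies `P` by `e^{2B₁}`).  Transversality `κ` of the minimiser's sup-plaquette variable with
respect to the integration variables is NOT PRINTED (§5). -/

/-- **GAUSSIAN ONE-SITE ANTI-CONCENTRATION, uniform in the mean**: `N(m, v)([a, b]) ≤ (b − a)/√(2πv)` for `v ≠ 0`.
[folklore] -/
theorem gaussianReal_Icc_le (m : ℝ) {v : ℝ≥0} (hv : v ≠ 0) (a b : ℝ) :
    gaussianReal m v (Set.Icc a b) ≤ ENNReal.ofReal ((b - a) / Real.sqrt (2 * Real.pi * v)) := by
  rw [gaussianReal_apply _ hv]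
  have hP : 0 ≤ (Real.sqrt (2 * Real.pi * v))⁻¹ := by positivity
  -- the density is bounded by its value at the mean, uniformly in the mean (cf. the landed
  -- `Literature.MathematicalPhysics.KineticTheory.gaussianPDFReal_le`, not imported here to keep the import cone small)
  have hpeak : ∀ x, gaussianPDFReal m v x ≤ (Real.sqrt (2 * Real.pi * v))⁻¹ := fun x => by
    rw [gaussianPDFReal_def]
    refine mul_le_of_le_one_right hP ?_
    rw [Real.exp_le_one_iff, neg_div]
    exact neg_nonpos.2 (div_nonneg (sq_nonneg _) (by positivity))
  calc ∫⁻ x in Set.Icc a b, gaussianPDF m v x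
      ≤ ∫⁻ _ in Set.Icc a b, ENNReal.ofReal ((Real.sqrt (2 * Real.pi * v))⁻¹) := by
        refine lintegral_mono fun x => ?_
        exact ENNReal.ofReal_le_ofReal (hpeak x)
    _ = ENNReal.ofReal ((Real.sqrt (2 * Real.pi * v))⁻¹) * volume (Set.Icc a b) := setLIntegral_const _ _
    _ = ENNReal.ofReal ((b - a) / Real.sqrt (2 * Real.pi * v)) := by
        rw [Real.volume_Icc, ← ENNReal.ofReal_mul hP]
        congr 1
        ring

/-- A UNIFORM DENSITY BOUND for a measure on `ℝ`: every interval `[a, b]` has mass at most `P·(b − a)`.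
(Hypothesis shape; `gaussianReal` satisfies it with `P = 1/√(2πv)`.) [folklore] -/
def DensityBound (μ : Measure ℝ) (P : ℝ) : Prop :=
  ∀ a b, a ≤ b → μ (Set.Icc a b) ≤ ENNReal.ofReal (P * (b - a))

/-- the Gaussian law has density bound `1/√(2πv)`, whatever its mean. [folklore] -/
theorem densityBound_gaussianReal (m : ℝ) {v : ℝ≥0} (hv : v ≠ 0) :
    DensityBound (gaussianReal m v) (Real.sqrt (2 * Real.pi * v))⁻¹ := by
  intro a b _
  have h := gaussianReal_Icc_le m hv a b
  rwa [div_eq_inv_mul] at h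

/-- **TRANSVERSALITY ⇒ THE PREIMAGE OF A WINDOW IS SHORT.**  If `φ` has slope at least `κ > 0` (`κ(y − x) ≤ φ y − φ x`
for `x ≤ y`), the set where `φ` lies in a window `[c, c + δ)` is contained in an interval of length `2δ/κ` around any of
its points. [folklore] -/
theorem preimage_window_subset_Icc {φ : ℝ → ℝ} {κ : ℝ} (hκ : 0 < κ)
    (hslope : ∀ x y, x ≤ y → κ * (y - x) ≤ φ y - φ x) {c δ x₀ : ℝ} (hx₀ : φ x₀ ∈ Set.Ico c (c + δ)) :
    φ ⁻¹' Set.Ico c (c + δ) ⊆ Set.Icc (x₀ - δ / κ) (x₀ + δ / κ) := by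
  intro x hx
  simp only [Set.mem_preimage, Set.mem_Ico] at hx hx₀
  have hδ : 0 < δ := by linarith [hx₀.1, hx₀.2]
  have hδκ : 0 < δ / κ := div_pos hδ hκ
  have hkey : κ * (δ / κ) = δ := mul_div_cancel₀ _ hκ.ne'
  constructor
  · -- `x₀ - δ/κ ≤ x`: else `φ x₀ - φ x ≥ κ (x₀ - x) > δ`
    by_contra h
    rw [not_le] at h
    have h1 := hslope x x₀ (by linarith)
    have h2 : κ * (δ / κ) < κ * (x₀ - x) := mul_lt_mul_of_pos_left (by linarith) hκ
    linarith
  · by_contra h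
    rw [not_le] at h
    have h1 := hslope x₀ x (by linarith)
    have h2 : κ * (δ / κ) < κ * (x - x₀) := mul_lt_mul_of_pos_left (by linarith) hκ
    linarith

/-- **SHELL MASS ALONG A TRANSVERSAL FIBRE** (device (b)): density bound `P` for the fibre law and slope `≥ κ` for the
tested variable along the fibre give mass `≤ 2Pδ/κ` for the window `{c ≤ φ < c + δ}` (`δ = ρθ` for the shell of B14
(2.17) at relative width `ρ`). [folklore] -/
theorem measure_preimage_window_le {μ : Measure ℝ} {P : ℝ} (hμ : DensityBound μ P) {φ : ℝ → ℝ} {κ : ℝ}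
    (hκ : 0 < κ) (hslope : ∀ x y, x ≤ y → κ * (y - x) ≤ φ y - φ x) (c δ : ℝ) :
    μ (φ ⁻¹' Set.Ico c (c + δ)) ≤ ENNReal.ofReal (P * (2 * δ / κ)) := by
  by_cases hne : (φ ⁻¹' Set.Ico c (c + δ)).Nonempty
  · obtain ⟨x₀, hx₀⟩ := hne
    have hsub := preimage_window_subset_Icc hκ hslope (c := c) (δ := δ) (x₀ := x₀) hx₀
    have hδ : 0 ≤ δ := by
      simp only [Set.mem_preimage, Set.mem_Ico] at hx₀
      linarith [hx₀.1, hx₀.2]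
    refine (measure_mono hsub).trans ((hμ _ _ (by
      have : 0 ≤ δ / κ := by positivity
      linarith)).trans (le_of_eq ?_))
    congr 1
    ring
  · rw [Set.not_nonempty_iff_eq_empty.mp hne, measure_empty]
    exact bot_le

/-! ## §1(c) Threshold averaging (no smoothness; needs threshold-choice freedom inside the printed slack)

Dictionary.  `S i`, `i < n`, is the total shell weight of the run if its (global) threshold parameter is set to the
`i`-th of `n` candidate values whose shells are pairwise DISJOINT and all lie inside the slack of the printed ladder
(B15 (1.22)–(1.23): thresholds between `(1 − β)θ` and `θ`); disjointness gives `Σ_i S i ≤` total weight.  Then some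
candidate threshold carries shell weight `≤ total/n`.  LOCATED, NOT PRINTED: that every inductive bound of the run is
uniform over the candidate thresholds (record §3 (δ)). -/

/-- **PIGEONHOLE OVER CANDIDATE THRESHOLDS** (device (c)). [folklore] -/
theorem exists_threshold_shell_le {n : ℕ} (hn : 0 < n) {S : ℕ → ℝ} {Z : ℝ}
    (hsum : ∑ i ∈ range n, S i ≤ Z) : ∃ i ∈ range n, S i ≤ Z / n := by
  have hne : (range n).Nonempty := nonempty_range_iff.mpr hn.ne'
  refine exists_le_of_sum_le hne ?_
  calc ∑ i ∈ range n, S i ≤ Z := hsum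
    _ = ∑ _i ∈ range n, Z / n := by
        rw [sum_const, card_range, nsmul_eq_mul]
        field_simp

/-- Disjoint candidate shells of nonnegative pointwise weight sum to at most the total: if `S i = Σ_τ f τ·1[τ ∈ E i]`
with the events `E i` pairwise disjoint and `0 ≤ f`, then `Σ_i S i ≤ Σ_τ f τ`. [folklore] -/
theorem sum_disjoint_shells_le {ι : Type*} [DecidableEq ι] (T : Finset ι) {n : ℕ} (E : ℕ → Finset ι)
    (hdisj : ∀ i < n, ∀ i' < n, i ≠ i' → Disjoint (E i) (E i')) {f : ι → ℝ} (hf : ∀ τ ∈ T, 0 ≤ f τ) :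
    ∑ i ∈ range n, ∑ τ ∈ T ∩ E i, f τ ≤ ∑ τ ∈ T, f τ := by
  classical
  have hpd : Set.PairwiseDisjoint (↑(range n) : Set ℕ) (fun i => T ∩ E i) := by
    intro i hi i' hi' hne
    have h := hdisj i (mem_range.mp hi) i' (mem_range.mp hi') hne
    exact disjoint_of_subset_left inter_subset_right (disjoint_of_subset_right inter_subset_right h)
  rw [← sum_biUnion hpd]
  refine sum_le_sum_of_subset_of_nonneg ?_ (fun τ hτ _ => hf τ hτ)
  intro τ hτ
  simp only [mem_biUnion, mem_inter] at hτ
  obtain ⟨i, _, hτT, _⟩ := hτ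
  exact hτT

/-! ## §2 The slot ledger (finite-sum algebra)

Dictionary.  `T` = the terms of ONE run at `K` steps and source `t` (B14 (2.18)), `A τ ≥ 0` their weights, `sh τ` the
term's shell part (`T4IndicatorShell.sum_shell_le_prod`: the sum of its per-slot shell pieces); `S` = the SLOTS of the
run (background-mediated indicator factors: a cube `□` of B14 (2.17) at some level `j = lvl s`, a component function of
B15 (1.22)–(1.23), …); `piece s τ ≥ 0` = the part of `sh τ` attributable to slot `s`; `c s` = the slot's relative
anti-concentration constant (`D_{lvl s}·ρ_{lvl s}` from §1 and §5). -/

/-- **SLOT LEDGER.**  If every term's shell part is covered by its per-slot pieces and each slot's pieces weigh at most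
`c s ×` the total weight, the shell part of the run weighs at most `(Σ_s c s) ×` the total weight. [folklore] -/
theorem shell_sum_le_of_slots {ι σ : Type*} (T : Finset ι) (S : Finset σ) (sh A : ι → ℝ) (piece : σ → ι → ℝ)
    (c : σ → ℝ) (hcover : ∀ τ ∈ T, sh τ ≤ ∑ s ∈ S, piece s τ)
    (hslot : ∀ s ∈ S, ∑ τ ∈ T, piece s τ ≤ c s * ∑ τ ∈ T, A τ) :
    ∑ τ ∈ T, sh τ ≤ (∑ s ∈ S, c s) * ∑ τ ∈ T, A τ := by
  calc ∑ τ ∈ T, sh τ ≤ ∑ τ ∈ T, ∑ s ∈ S, piece s τ := sum_le_sum hcover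
    _ = ∑ s ∈ S, ∑ τ ∈ T, piece s τ := sum_comm
    _ ≤ ∑ s ∈ S, c s * ∑ τ ∈ T, A τ := sum_le_sum hslot
    _ = (∑ s ∈ S, c s) * ∑ τ ∈ T, A τ := by rw [sum_mul]

/-- COUNTING BY LEVEL: if the constant of a slot depends only on its level, `Σ_s c(lvl s) = Σ_j ν_j · c_j` with
`ν_j` the number of slots at level `j` (all levels in the window `J`). [folklore] -/
theorem sum_slots_eq_sum_levels {σ : Type*} (S : Finset σ) (J : Finset ℕ) (lvl : σ → ℕ) (c : ℕ → ℝ)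
    (hJ : ∀ s ∈ S, lvl s ∈ J) :
    ∑ s ∈ S, c (lvl s) = ∑ j ∈ J, ((S.filter fun s => lvl s = j).card : ℝ) * c j := by
  rw [← sum_fiberwise_of_maps_to' hJ]
  refine sum_congr rfl fun j _ => ?_
  rw [sum_const, nsmul_eq_mul]

/-- … hence `Σ_s c(lvl s) ≤ Σ_j ν̄_j c_j` for any bounds `ν̄_j` on the slot counts (`c ≥ 0`). [folklore] -/
theorem sum_slots_le_sum_levels {σ : Type*} (S : Finset σ) (J : Finset ℕ) (lvl : σ → ℕ) (c ν : ℕ → ℝ)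
    (hJ : ∀ s ∈ S, lvl s ∈ J) (hc : ∀ j ∈ J, 0 ≤ c j)
    (hν : ∀ j ∈ J, ((S.filter fun s => lvl s = j).card : ℝ) ≤ ν j) :
    ∑ s ∈ S, c (lvl s) ≤ ∑ j ∈ J, ν j * c j := by
  rw [sum_slots_eq_sum_levels S J lvl c hJ]
  exact sum_le_sum fun j hj => mul_le_mul_of_nonneg_right (hν j hj) (hc j hj)

/-! ## §3 The arithmetic: bounded window of live levels + rate form of sup-closeness ⇒ geometric bound

Dictionary.  At `K` steps the live slots sit at levels `j ∈ J K` with `K ≤ j + N₁` (a BOUNDED WINDOW below the top —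
record §0(e) of `t4/T4-EST-U5bE2.md`: levels older than `K − N(ḡ) − O(1)` are synchronised by node U5a and carry no
shell), at most `N₁ + 1` of them; `ν K j ≤ ν̄` slots per level (on the unit torus `ν̄ = v₀Λ^{N₁}`, `Λ = L⁴`); the
anti-concentration constants `D j ≤ D̄`; and the RATE FORM of the two runs' sup-closeness (node U1b, species NE3,
`T4EtaRateMin.LocalRate`): relative shell width `ρ j ≤ c₁ϑ^j`, `0 < ϑ < 1`. -/

/-- **THE WINDOW SUM IS GEOMETRIC IN `K`.** [folklore] -/
theorem levelSum_le_geometric (J : Finset ℕ) (K N₁ : ℕ) (ν D ρ : ℕ → ℝ) {νbar Dbar c₁ ϑ : ℝ}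
    (hϑ0 : 0 < ϑ) (hϑ1 : ϑ ≤ 1) (hνbar : 0 ≤ νbar) (hDbar : 0 ≤ Dbar) (hc₁ : 0 ≤ c₁)
    (hwin : ∀ j ∈ J, K ≤ j + N₁) (hcard : (J.card : ℝ) ≤ N₁ + 1)
    (hν : ∀ j ∈ J, ν j ≤ νbar) (hD0 : ∀ j ∈ J, 0 ≤ D j) (hD : ∀ j ∈ J, D j ≤ Dbar)
    (hρ0 : ∀ j ∈ J, 0 ≤ ρ j) (hρ : ∀ j ∈ J, ρ j ≤ c₁ * ϑ ^ j) :
    ∑ j ∈ J, ν j * (D j * ρ j) ≤ ((N₁ + 1) * νbar * Dbar * c₁ * ϑ⁻¹ ^ N₁) * ϑ ^ K := by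
  have hterm : ∀ j ∈ J, ν j * (D j * ρ j) ≤ νbar * Dbar * c₁ * ϑ⁻¹ ^ N₁ * ϑ ^ K := by
    intro j hj
    have hpow : ϑ ^ j ≤ ϑ⁻¹ ^ N₁ * ϑ ^ K := by
      have h1 : ϑ ^ (j + N₁) ≤ ϑ ^ K := pow_le_pow_of_le_one hϑ0.le hϑ1 (hwin j hj)
      have h2 : ϑ ^ j = ϑ⁻¹ ^ N₁ * ϑ ^ (j + N₁) := by
        rw [pow_add, inv_pow, mul_comm, mul_assoc, mul_inv_cancel₀ (pow_ne_zero _ hϑ0.ne'), mul_one]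
      rw [h2]
      exact mul_le_mul_of_nonneg_left h1 (by positivity)
    calc ν j * (D j * ρ j) ≤ νbar * (Dbar * (c₁ * ϑ ^ j)) := by
          refine mul_le_mul (hν j hj) ?_ (mul_nonneg (hD0 j hj) (hρ0 j hj)) hνbar
          exact mul_le_mul (hD j hj) (hρ j hj) (hρ0 j hj) hDbar
      _ ≤ νbar * (Dbar * (c₁ * (ϑ⁻¹ ^ N₁ * ϑ ^ K))) := by gcongr
      _ = νbar * Dbar * c₁ * ϑ⁻¹ ^ N₁ * ϑ ^ K := by ring
  calc ∑ j ∈ J, ν j * (D j * ρ j) ≤ ∑ _j ∈ J, νbar * Dbar * c₁ * ϑ⁻¹ ^ N₁ * ϑ ^ K := sum_le_sum hterm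
    _ = J.card * (νbar * Dbar * c₁ * ϑ⁻¹ ^ N₁ * ϑ ^ K) := by rw [sum_const, nsmul_eq_mul]
    _ ≤ (N₁ + 1) * (νbar * Dbar * c₁ * ϑ⁻¹ ^ N₁ * ϑ ^ K) :=
        mul_le_mul_of_nonneg_right hcard (by positivity)
    _ = ((N₁ + 1) * νbar * Dbar * c₁ * ϑ⁻¹ ^ N₁) * ϑ ^ K := by ring

/-- a nonnegative sequence under a geometric majorant is summable. [folklore] -/
theorem summable_of_le_geometric {ω : ℕ → ℝ} {C ϑ : ℝ} (hϑ0 : 0 ≤ ϑ) (hϑ1 : ϑ < 1) (h0 : ∀ K, 0 ≤ ω K)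
    (hω : ∀ K, ω K ≤ C * ϑ ^ K) : Summable ω :=
  Summable.of_nonneg_of_le h0 hω ((summable_geometric_of_lt_one hϑ0 hϑ1).mul_left C)

/-- … and eventually below any `ε > 0` (the smallness `Wsh K < 1 − W K` needed by
`T4IndicatorShell.relWeightBound_ref`). [folklore] -/
theorem eventually_lt_of_le_geometric {ω : ℕ → ℝ} {C ϑ : ℝ} (hϑ0 : 0 ≤ ϑ) (hϑ1 : ϑ < 1)
    (hω : ∀ K, ω K ≤ C * ϑ ^ K) {ε : ℝ} (hε : 0 < ε) : ∀ᶠ K in Filter.atTop, ω K < ε := by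
  have hlim : Filter.Tendsto (fun K => C * ϑ ^ K) Filter.atTop (nhds 0) := by
    simpa using (tendsto_pow_atTop_nhds_zero_of_lt_one hϑ0 hϑ1).const_mul C
  filter_upwards [(tendsto_order.mp hlim).2 ε hε] with K hK using (hω K).trans_lt hK

/-! ## §4 The constructor of `T4IndicatorShell.ShellWeightBound` from the two runs' slot ledgers -/

/-- A PER-RUN SLOT LEDGER for the term family `A : ℕ → ℝ → ι → ℝ` with shell parts `sh` on `|t| ≤ l₀`: slots `S K`,
per-slot pieces covering the shell parts, per-slot relative bounds `c K s ≥ 0`, and `0 ≤ sh ≤ A` term-wise.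
(Hypothesis shape for ONE run; its per-slot field `slot` is where §5's `SlotAntiConcentration` enters.) [folklore] -/
structure SlotLedger {ι σ : Type*} (l₀ : ℝ) (T : ℕ → Finset ι) (A sh : ℕ → ℝ → ι → ℝ) (S : ℕ → Finset σ)
    (piece : ℕ → ℝ → σ → ι → ℝ) (c : ℕ → σ → ℝ) : Prop where
  /-- shell parts are nonnegative -/
  sh_nonneg : ∀ K t, |t| ≤ l₀ → ∀ τ ∈ T K, 0 ≤ sh K t τ
  /-- the shell part of a term never exceeds the term -/
  sh_le : ∀ K t, |t| ≤ l₀ → ∀ τ ∈ T K, sh K t τ ≤ A K t τ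
  /-- every term's shell part is covered by its per-slot pieces -/
  cover : ∀ K t, |t| ≤ l₀ → ∀ τ ∈ T K, sh K t τ ≤ ∑ s ∈ S K, piece K t s τ
  /-- per slot, the pieces weigh at most `c K s ×` the total weight (anti-concentration, §5) -/
  slot : ∀ K t, |t| ≤ l₀ → ∀ s ∈ S K, ∑ τ ∈ T K, piece K t s τ ≤ c K s * ∑ τ ∈ T K, A K t τ
  /-- the per-slot constants are nonnegative -/
  c_nonneg : ∀ K, ∀ s ∈ S K, 0 ≤ c K s

namespace SlotLedger

variable {ι σ : Type*} {l₀ : ℝ} {T : ℕ → Finset ι} {A sh : ℕ → ℝ → ι → ℝ} {S : ℕ → Finset σ}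
  {piece : ℕ → ℝ → σ → ι → ℝ} {c : ℕ → σ → ℝ}

/-- the per-run relative shell weight of a slot ledger: `ω K = Σ_{s ∈ S K} c K s`. [folklore] -/
def omega (_h : SlotLedger l₀ T A sh S piece c) (K : ℕ) : ℝ := ∑ s ∈ S K, c K s

/-- the relative shell weight is nonnegative. [folklore] -/
theorem omega_nonneg (h : SlotLedger l₀ T A sh S piece c) (K : ℕ) : 0 ≤ h.omega K :=
  sum_nonneg (h.c_nonneg K)

/-- the run's shell part weighs at most `ω K ×` its total weight. [folklore] -/
theorem sum_sh_le (h : SlotLedger l₀ T A sh S piece c) (K : ℕ) {t : ℝ} (ht : |t| ≤ l₀) :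
    ∑ τ ∈ T K, sh K t τ ≤ h.omega K * ∑ τ ∈ T K, A K t τ :=
  shell_sum_le_of_slots (T K) (S K) (sh K t) (A K t) (piece K t) (c K) (h.cover K t ht) (h.slot K t ht)

/-- the total weight is nonnegative (`0 ≤ sh ≤ A` term-wise). [folklore] -/
theorem sum_A_nonneg (h : SlotLedger l₀ T A sh S piece c) (K : ℕ) {t : ℝ} (ht : |t| ≤ l₀) :
    0 ≤ ∑ τ ∈ T K, A K t τ :=
  sum_nonneg fun τ hτ => (h.sh_nonneg K t ht τ hτ).trans (h.sh_le K t ht τ hτ)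

end SlotLedger

/-- **THE CONSTRUCTOR (NE7c, shell-measure route).**  Two per-run slot ledgers whose relative shell weights are under
geometric majorants `C·ϑ^K` (§3) give `T4IndicatorShell.ShellWeightBound l₀ T A B shA shB Wsh` with
`Wsh K = ω^A K + ω^B K` — nonnegative, summable — ready for `T4IndicatorShell.relWeightBound_ref` /
`cauchy_of_relWeightBound_shell`. [folklore] -/
theorem shellWeightBound_of_slotLedger {ι σ σ' : Type*} {l₀ : ℝ} {T : ℕ → Finset ι}
    {A B shA shB : ℕ → ℝ → ι → ℝ} {SA : ℕ → Finset σ} {SB : ℕ → Finset σ'}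
    {pieceA : ℕ → ℝ → σ → ι → ℝ} {pieceB : ℕ → ℝ → σ' → ι → ℝ} {cA : ℕ → σ → ℝ} {cB : ℕ → σ' → ℝ}
    (hA : SlotLedger l₀ T A shA SA pieceA cA) (hB : SlotLedger l₀ T B shB SB pieceB cB)
    {C ϑ : ℝ} (hϑ0 : 0 ≤ ϑ) (hϑ1 : ϑ < 1) (hωA : ∀ K, hA.omega K ≤ C * ϑ ^ K)
    (hωB : ∀ K, hB.omega K ≤ C * ϑ ^ K) :
    T4IndicatorShell.ShellWeightBound l₀ T A B shA shB (fun K => hA.omega K + hB.omega K) where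
  nonneg K := add_nonneg (hA.omega_nonneg K) (hB.omega_nonneg K)
  summable := (summable_of_le_geometric hϑ0 hϑ1 hA.omega_nonneg hωA).add
    (summable_of_le_geometric hϑ0 hϑ1 hB.omega_nonneg hωB)
  sh_nonneg_left := hA.sh_nonneg
  sh_le_left := hA.sh_le
  sh_nonneg_right := hB.sh_nonneg
  sh_le_right := hB.sh_le
  left K t ht := by
    have h := hA.sum_sh_le K ht
    have hZ := hA.sum_A_nonneg K ht
    nlinarith [hB.omega_nonneg K]
  right K t ht := by
    have h := hB.sum_sh_le K ht
    have hZ := hB.sum_A_nonneg K ht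
    nlinarith [hA.omega_nonneg K]

/-- … and the weights are eventually below any `ε > 0` (take `ε = 1 − sup W` for `relWeightBound_ref`). [folklore] -/
theorem eventually_omega_add_lt {ι σ σ' : Type*} {l₀ : ℝ} {T : ℕ → Finset ι}
    {A B shA shB : ℕ → ℝ → ι → ℝ} {SA : ℕ → Finset σ} {SB : ℕ → Finset σ'}
    {pieceA : ℕ → ℝ → σ → ι → ℝ} {pieceB : ℕ → ℝ → σ' → ι → ℝ} {cA : ℕ → σ → ℝ} {cB : ℕ → σ' → ℝ}
    (hA : SlotLedger l₀ T A shA SA pieceA cA) (hB : SlotLedger l₀ T B shB SB pieceB cB)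
    {C ϑ : ℝ} (hϑ0 : 0 ≤ ϑ) (hϑ1 : ϑ < 1) (hωA : ∀ K, hA.omega K ≤ C * ϑ ^ K)
    (hωB : ∀ K, hB.omega K ≤ C * ϑ ^ K) {ε : ℝ} (hε : 0 < ε) :
    ∀ᶠ K in Filter.atTop, hA.omega K + hB.omega K < ε := by
  have h2 : ∀ K, hA.omega K + hB.omega K ≤ (2 * C) * ϑ ^ K := fun K => by
    have := hωA K; have := hωB K; linarith
  exact eventually_lt_of_le_geometric hϑ0 hϑ1 h2 hε

/-! ## §5 The first non-printed step, typed: per-slot anti-concentration at relative scale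

`SlotAntiConcentration μ u θ ρ D`: under the run's positive measure `μ` at fixed source (all of B14 (2.18) with the
slot's own indicator factor removed, or the fibre of the slot's pending operation), the shell `{θ(1 − ρ) ≤ u < θ}` of
the slot's tested variable `u` has mass at most `D·ρ ×` the total mass.  Per slot at level `j` the route needs it with
`D = D_j` INDEPENDENT OF `K` and `ρ = ρ_j` the relative sup-closeness radius of node U1b; then `c K s = D_j ρ_j` in the
slot ledger (§4) after pushing the measure statement through the expansion (the pieces of slot `s` sum, over terms, to
the `μ`-mass of the shell event times the remaining nonnegative factors — B14 (2.18) is a sum of nonnegative terms).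
GROUNDINGS (none printed; record §3): (α) gauge-fixed link dilation / (β) background-coordinate dilation ⇒ §1(a) with
`B ≲ (LM₂R_j)⁴ε_j²/g_j² + O((LM₂R_j)⁴)`; (γ) transversal fibre + Gaussian density ⇒ §1(b) with `D ≈ 2Pθ/(κ·mass)`;
(δ) threshold averaging ⇒ §1(c) with `D ≈ 1/(β·n·ρ)`-type constants and NO smoothness, at the price of
threshold-choice freedom; (ε) co-area.  WHY IT MIGHT FAIL: the tested variable is a sup over `∼ (LM₂R_j L^j)⁴` fine
plaquettes of a NONLINEAR function (the minimiser) of all integration variables; a density bound for its law at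
relative scale `ρ_j ∼ L^{−α′j}` uniform in `K` and in the history `Z` is a genuinely new estimate. -/

/-- NAMED HYPOTHESIS SHAPE (M1), NOT PRINTED, NOT asserted: anti-concentration of ONE slot's tested variable at
relative scale `ρ` below its threshold `θ`, relative to the total mass, with constant `D`. [folklore] -/
def SlotAntiConcentration {Ω : Type*} [MeasurableSpace Ω] (μ : Measure Ω) (u : Ω → ℝ) (θ ρ D : ℝ) : Prop :=
  μ {x | θ * (1 - ρ) ≤ u x ∧ u x < θ} ≤ ENNReal.ofReal (D * ρ) * μ Set.univ

/-- the shell event is the preimage of the window `[θ(1 − ρ), θ(1 − ρ) + ρθ)`. [folklore] -/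
theorem shell_eq_preimage {Ω : Type*} (u : Ω → ℝ) (θ ρ : ℝ) :
    {x | θ * (1 - ρ) ≤ u x ∧ u x < θ} = u ⁻¹' Set.Ico (θ * (1 - ρ)) (θ * (1 - ρ) + θ * ρ) := by
  ext x
  simp only [Set.mem_setOf_eq, Set.mem_preimage, Set.mem_Ico]
  constructor <;> rintro ⟨h1, h2⟩ <;> exact ⟨h1, by linarith⟩

/-- **REDUCTION OF (M1) TO DEVICE (b) IN THE EXACTLY TRANSVERSAL ONE-DIMENSIONAL CASE.**  If the slot variable is read
along a real coordinate, `u = φ ∘ ξ` with `ξ : Ω → ℝ` measurable, the law `μ.map ξ` has density bound `P`, `φ` has slope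
`≥ κ > 0`, and the total mass is at least `Z₀ > 0`, then `SlotAntiConcentration μ u θ ρ D` holds with
`D = 2Pθ/(κ Z₀)` (for `θ, ρ ≥ 0`).  The honest content of grounding (γ): in Bałaban's setting neither the transversal
coordinate nor `κ` is printed. [folklore] -/
theorem slotAntiConcentration_of_transversal {Ω : Type*} [MeasurableSpace Ω] {μ : Measure Ω} [IsFiniteMeasure μ]
    {ξ : Ω → ℝ} (hξ : Measurable ξ) {P : ℝ} (hP : 0 ≤ P) (hdens : DensityBound (μ.map ξ) P)
    {φ : ℝ → ℝ} {κ : ℝ} (hκ : 0 < κ) (hslope : ∀ x y, x ≤ y → κ * (y - x) ≤ φ y - φ x)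
    {θ ρ Z₀ : ℝ} (hθ : 0 ≤ θ) (hρ : 0 ≤ ρ) (hZ₀ : 0 < Z₀) (hmass : ENNReal.ofReal Z₀ ≤ μ Set.univ) :
    SlotAntiConcentration μ (φ ∘ ξ) θ ρ (2 * P * θ / (κ * Z₀)) := by
  unfold SlotAntiConcentration
  rw [shell_eq_preimage, Set.preimage_comp]
  -- pass to the law of ξ
  have h1 : μ (ξ ⁻¹' (φ ⁻¹' Set.Ico (θ * (1 - ρ)) (θ * (1 - ρ) + θ * ρ)))
      ≤ (μ.map ξ) (φ ⁻¹' Set.Ico (θ * (1 - ρ)) (θ * (1 - ρ) + θ * ρ)) :=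
    Measure.le_map_apply hξ.aemeasurable _
  have h2 := measure_preimage_window_le hdens hκ hslope (θ * (1 - ρ)) (θ * ρ)
  refine h1.trans (h2.trans ?_)
  -- P·(2θρ/κ) = (2Pθ/(κZ₀))·ρ·Z₀ ≤ (2Pθ/(κZ₀))·ρ · μ univ
  have hnum : P * (2 * (θ * ρ) / κ) = (2 * P * θ / (κ * Z₀) * ρ) * Z₀ := by
    field_simp
  rw [hnum, ENNReal.ofReal_mul (by positivity)]
  exact mul_le_mul' le_rfl hmass

/-- **FROM (M1) TO THE SLOT LEDGER FIELD.**  The measure-level shape pushed to term weights: if the pieces of slot `s`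
sum over the terms to (at most) a constant `M ≥ 0` times the shell mass, and the term weights sum to `M` times the
total mass (the same remaining nonnegative factors — B14 (2.18)), then `SlotAntiConcentration μ u θ ρ D` gives the
ledger inequality `Σ_τ piece τ ≤ (D ρ)·Σ_τ A τ` (all masses finite, `D, ρ ≥ 0`). [folklore] -/
theorem slot_field_of_antiConcentration {Ω ι : Type*} [MeasurableSpace Ω] {μ : Measure Ω} [IsFiniteMeasure μ]
    {u : Ω → ℝ} {θ ρ D : ℝ} (hD : 0 ≤ D) (hρ : 0 ≤ ρ) (hac : SlotAntiConcentration μ u θ ρ D)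
    (T : Finset ι) {piece A : ι → ℝ} {M : ℝ} (hM : 0 ≤ M)
    (hpiece : ∑ τ ∈ T, piece τ ≤ M * (μ {x | θ * (1 - ρ) ≤ u x ∧ u x < θ}).toReal)
    (hA : M * (μ Set.univ).toReal ≤ ∑ τ ∈ T, A τ) :
    ∑ τ ∈ T, piece τ ≤ (D * ρ) * ∑ τ ∈ T, A τ := by
  have hfin : μ {x | θ * (1 - ρ) ≤ u x ∧ u x < θ} ≠ ⊤ := measure_ne_top _ _
  have hfin' : μ Set.univ ≠ ⊤ := measure_ne_top _ _
  have hreal : (μ {x | θ * (1 - ρ) ≤ u x ∧ u x < θ}).toReal ≤ D * ρ * (μ Set.univ).toReal := by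
    have := ENNReal.toReal_mono (ENNReal.mul_ne_top ENNReal.ofReal_ne_top hfin') hac
    rwa [ENNReal.toReal_mul, ENNReal.toReal_ofReal (by positivity)] at this
  calc ∑ τ ∈ T, piece τ ≤ M * (μ {x | θ * (1 - ρ) ≤ u x ∧ u x < θ}).toReal := hpiece
    _ ≤ M * (D * ρ * (μ Set.univ).toReal) := mul_le_mul_of_nonneg_left hreal hM
    _ = (D * ρ) * (M * (μ Set.univ).toReal) := by ring
    _ ≤ (D * ρ) * ∑ τ ∈ T, A τ := mul_le_mul_of_nonneg_left hA (by positivity)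

/-! ## §6 Closure by threshold averaging (grounding (δ)): candidate shells, the two-run pigeonhole, tilt transfer

Dictionary.  For a slot level with threshold `θ` and relative closeness radius `ρ`, the CANDIDATE thresholds are
`θ_i = θ(1 − ρ)^i`, `i < n`, with candidate shells `[θ_{i+1}, θ_i)`: pairwise disjoint (`candShell_disjoint`) and all
inside the slack window `[θ(1 − nρ), θ)` (`candShell_subset_window`, Bernoulli), so `n ≈ β′/ρ` candidates fit under a
printed ladder slack `β′` (B15 (1.22)–(1.23)).  Because the partition functions compared by the uniqueness argument do
NOT depend on the thresholds (the expansion re-represents the same density — B15 p. 193 *"All the above transformations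
preserve the k-th density ρ_k, they change only the representation of this density"*), the threshold may be chosen per
number of steps `K`; the same choice serves both runs (`exists_common_threshold`: some candidate makes BOTH runs' shell
fractions `≤ 2ν/n`, `ν` = number of slots at the level) and, by TILT TRANSFER (`ratio_transfer_of_tilt`: a bound at source
`t = 0` transfers to `|t| ≤ l₀` at the cost `e^{2a}`, `a = l₀·sup|source|`), all sources at once.  LOCATED, NOT PRINTED:
(L1) every single-run inductive bound is uniform over threshold factors in `[1 − β′, 1]`; (L2) for history-dependent
slots the shell weights are read at measure level through the density-preserving re-representation. -/

/-- the `i`-th CANDIDATE SHELL below `θ` at relative width `ρ`: `[θ(1 − ρ)^{i+1}, θ(1 − ρ)^i)`. [folklore] -/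
def candShell (θ ρ : ℝ) (i : ℕ) : Set ℝ := Set.Ico (θ * (1 - ρ) ^ (i + 1)) (θ * (1 - ρ) ^ i)

/-- candidate shells are pairwise disjoint (`0 ≤ θ`, `0 ≤ ρ ≤ 1`). [folklore] -/
theorem candShell_disjoint {θ ρ : ℝ} (hθ : 0 ≤ θ) (hρ0 : 0 ≤ ρ) (hρ1 : ρ ≤ 1) {i i' : ℕ} (h : i ≠ i') :
    Disjoint (candShell θ ρ i) (candShell θ ρ i') := by
  have key : ∀ {j j' : ℕ}, j < j' → Disjoint (candShell θ ρ j) (candShell θ ρ j') := by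
    intro j j' hjj'
    rw [Set.disjoint_left]
    intro x hx hx'
    simp only [candShell, Set.mem_Ico] at hx hx'
    have hle : (1 - ρ) ^ j' ≤ (1 - ρ) ^ (j + 1) :=
      pow_le_pow_of_le_one (by linarith) (by linarith) (Nat.succ_le_of_lt hjj')
    have := mul_le_mul_of_nonneg_left hle hθ
    linarith [hx.2, hx'.1]
  rcases Nat.lt_or_gt_of_ne h with hlt | hgt
  · exact key hlt
  · exact (key hgt).symm

/-- the first `n` candidate shells lie inside the slack window `[θ(1 − nρ), θ)` (Bernoulli). [folklore] -/
theorem candShell_subset_window {θ ρ : ℝ} (hθ : 0 ≤ θ) (hρ0 : 0 ≤ ρ) (hρ1 : ρ ≤ 1) {i n : ℕ} (hi : i < n) :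
    candShell θ ρ i ⊆ Set.Ico (θ * (1 - n * ρ)) θ := by
  intro x hx
  simp only [candShell, Set.mem_Ico] at hx ⊢
  have h1ρ : 0 ≤ 1 - ρ := by linarith
  constructor
  · have hb : 1 + (n : ℝ) * (-ρ) ≤ (1 + (-ρ)) ^ n := one_add_mul_le_pow (by linarith) n
    have hpow : (1 - ρ) ^ n ≤ (1 - ρ) ^ (i + 1) :=
      pow_le_pow_of_le_one h1ρ (by linarith) (Nat.succ_le_of_lt hi)
    have : θ * (1 - n * ρ) ≤ θ * (1 - ρ) ^ (i + 1) := by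
      refine mul_le_mul_of_nonneg_left ?_ hθ
      calc 1 - (n : ℝ) * ρ = 1 + n * (-ρ) := by ring
        _ ≤ (1 + (-ρ)) ^ n := hb
        _ = (1 - ρ) ^ n := by ring
        _ ≤ (1 - ρ) ^ (i + 1) := hpow
    linarith [hx.1]
  · have hpow : (1 - ρ) ^ i ≤ 1 := pow_le_one₀ h1ρ (by linarith)
    have := mul_le_mul_of_nonneg_left hpow hθ
    linarith [hx.2]

/-- PER-SLOT DISJOINTNESS SUMS TO THE SLOT COUNT: if for every slot the weights of its `n` candidate shells sum to at
most the total weight `Z`, then the level's candidate totals sum to at most `ν·Z`, `ν` = number of slots. [folklore] -/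
theorem sum_candidates_le_card_mul {σ : Type*} (S : Finset σ) (n : ℕ) (f : σ → ℕ → ℝ) {Z : ℝ}
    (hf : ∀ s ∈ S, ∑ i ∈ range n, f s i ≤ Z) :
    ∑ i ∈ range n, ∑ s ∈ S, f s i ≤ S.card * Z := by
  rw [sum_comm]
  calc ∑ s ∈ S, ∑ i ∈ range n, f s i ≤ ∑ _s ∈ S, Z := sum_le_sum hf
    _ = S.card * Z := by rw [sum_const, nsmul_eq_mul]

/-- **THE TWO-RUN PIGEONHOLE** (grounding (δ) at one slot level): with `n ≥ 1` disjoint candidate shells per slot in each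
run (per-slot candidate weights summing to at most the run's total weight `ZA`, `ZB > 0`), SOME candidate threshold makes
the level's shell weight at most `(2ν/n) ×` the total weight in BOTH runs simultaneously. [folklore] -/
theorem exists_common_threshold {σ : Type*} (S : Finset σ) {n : ℕ} (hn : 0 < n) (fA fB : σ → ℕ → ℝ) {ZA ZB : ℝ}
    (hZA : 0 < ZA) (hZB : 0 < ZB) (hA0 : ∀ s ∈ S, ∀ i, 0 ≤ fA s i) (hB0 : ∀ s ∈ S, ∀ i, 0 ≤ fB s i)
    (hA : ∀ s ∈ S, ∑ i ∈ range n, fA s i ≤ ZA) (hB : ∀ s ∈ S, ∑ i ∈ range n, fB s i ≤ ZB) :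
    ∃ i ∈ range n, ∑ s ∈ S, fA s i ≤ (2 * S.card / n) * ZA ∧ ∑ s ∈ S, fB s i ≤ (2 * S.card / n) * ZB := by
  set g : ℕ → ℝ := fun i => (∑ s ∈ S, fA s i) / ZA + (∑ s ∈ S, fB s i) / ZB with hg
  have hsum : ∑ i ∈ range n, g i ≤ 2 * S.card := by
    have h1 : ∑ i ∈ range n, (∑ s ∈ S, fA s i) / ZA ≤ S.card := by
      rw [← sum_div, div_le_iff₀ hZA]
      exact sum_candidates_le_card_mul S n fA hA
    have h2 : ∑ i ∈ range n, (∑ s ∈ S, fB s i) / ZB ≤ S.card := by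
      rw [← sum_div, div_le_iff₀ hZB]
      exact sum_candidates_le_card_mul S n fB hB
    simp only [hg, sum_add_distrib]
    linarith
  obtain ⟨i, hi, hgi⟩ := exists_threshold_shell_le hn hsum
  have hAi : 0 ≤ (∑ s ∈ S, fA s i) / ZA := div_nonneg (sum_nonneg fun s hs => hA0 s hs i) hZA.le
  have hBi : 0 ≤ (∑ s ∈ S, fB s i) / ZB := div_nonneg (sum_nonneg fun s hs => hB0 s hs i) hZB.le
  refine ⟨i, hi, ?_, ?_⟩
  · have : (∑ s ∈ S, fA s i) / ZA ≤ 2 * S.card / n := by simp only [hg] at hgi; linarith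
    rwa [div_le_iff₀ hZA] at this
  · have : (∑ s ∈ S, fB s i) / ZB ≤ 2 * S.card / n := by simp only [hg] at hgi; linarith
    rwa [div_le_iff₀ hZB] at this

/-- **TILT TRANSFER**: a relative bound at one source value transfers to a tilted weight (`|t·source| ≤ a` pointwise:
`S ≤ e^a S₀`, `Z₀ ≤ e^a Z`) at the cost `e^{2a}` — one threshold choice per `K` serves all `|t| ≤ l₀`. [folklore] -/
theorem ratio_transfer_of_tilt {S₀ S Z₀ Z a q : ℝ} (hS : S ≤ Real.exp a * S₀) (hZ : Z₀ ≤ Real.exp a * Z)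
    (h0 : S₀ ≤ q * Z₀) (hq : 0 ≤ q) : S ≤ (Real.exp (2 * a) * q) * Z := by
  have he : 0 < Real.exp a := Real.exp_pos a
  have h2 : Real.exp (2 * a) = Real.exp a * Real.exp a := by rw [← Real.exp_add]; ring_nf
  calc S ≤ Real.exp a * S₀ := hS
    _ ≤ Real.exp a * (q * Z₀) := mul_le_mul_of_nonneg_left h0 he.le
    _ ≤ Real.exp a * (q * (Real.exp a * Z)) := by gcongr
    _ = (Real.exp (2 * a) * q) * Z := by rw [h2]; ring

/-! ## §7 Joint threshold choice over the live window (cross-read advisory A2): grid averaging, realized ledgers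

Dictionary.  At `K` steps the live levels form a finite index type `Λ` (ages `a = K − j`, `a ∈ Fin (N₁ + 1)`); a
JOINT ASSIGNMENT `c : Λ → ℕ` picks at every live level `l` the `c l`-th of `n l` candidate thresholds
`θ_l(1 − ρ_l)^{c l}` of §6, and the CANDIDATE GRID `candGrid n` is the product of the ranges `c l < n l`.  For
HISTORY-DEPENDENT slot families (the cubes tested at level `j` are those outside the older large-field regions, B14
(2.17)–(2.18), B15 (1.22)–(1.23)) the weight `fA l s c` of the shell pieces of slot `s` at level `l` depends on the
WHOLE assignment `c`, not only on its own coordinate `c l` — advisory A2 of the cell cross-read of v2 of this module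
(cell-internal cross-read record): §6's one-level pigeonhole `exists_common_threshold`
must NOT be iterated level by level.  The cure is to average over the whole grid.  Along the OWN coordinate of a slot
(all other thresholds frozen) its `n l` candidate shells are pairwise disjoint events of the level-`l` field, so their
weights sum to at most the run's total weight `Z` (hypotheses `hA`, `hB` below, for EVERY frozen assignment; their
measure-level reading is the located input (L2): the terms are nonnegative and the small/large partitions of unity at
every level commute with the insertion of a nonnegative function of the level-`l` field — B15 p. 193, the density is
preserved and only its representation changes — so `Σ_m fA l s (update c l m) ≤ ∫(density with Σ_m 1[u_s ∈ shell_m] ≤ 1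
inserted) ≤ Z`).  Averaging `Σ_l [Σ_s fA l s c / Z^A + Σ_s fB l s c / Z^B]` over `c ∈ candGrid n` fibre by fibre of the
coordinate projections (`sum_le_of_fibres`, `exists_joint_choice_of_fibres`; the fibre through `c` along `l` is
`{update c l m : m < n l}`, `filter_candGrid_update_eq`) yields ONE assignment serving ALL live levels and BOTH runs with
level-summed shell fractions `≤ Σ_l 2ν_l/n_l` (`exists_joint_common_threshold`), where `n_l = ⌊β′/ρ_l⌋₊` candidates fit
under the ladder slack `β′` (`candidateCount_spec`: `n_lρ_l ≤ β′` and `2/n_l ≤ (4/β′)ρ_l`; `candShell_subset_slack`),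
hence `≤ C·ϑ^K` on the bounded window with the rate form `ρ_{K,a} ≤ c₁ϑ^{K−a}` (`levelFraction_le_of_rate`,
`ageSum_le_geometric`, `exists_threshold_choice_function` — a choice FUNCTION `K ↦ c⋆_K`).  ORDER OF QUANTIFIERS: the
assignment `c⋆_K` is chosen FIRST (it involves only the candidate-weight functions at source `t = 0`), THEN the two
runs of the `K`-th comparison are the expansions written with the thresholds `c⋆_K` — legitimate representations of
the same densities by the located input (L1) (threshold-robustness of every single-run bound inside the slack) — and
their REALIZED LEDGERS (`SlotLedger.of_realized`: the per-slot constant is `e^{2a} ×` the realized shell fraction at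
`t = 0`, transferred to all `|t| ≤ l₀` by `ratio_transfer_of_tilt`) feed the §4 constructor
(`shellWeightBound_of_realized`: `Wsh K = ω^A_K + ω^B_K ≤ 2e^{2a}Cϑ^K`).  A different `K` may use a different
assignment: the compared quantities are INTEGRALS `Z_K(t) = Σ_τ A K t τ`, which do not depend on the representation
(advisory A1: after the ℝ operation B15 p. 193 replaces equality of densities by equality of integrals — *"the
equivalence means that both sides have equal integrals over the space of fields"* — which is all the comparison uses).
Nothing here is a statement about Bałaban's densities: finite-sum algebra over an abstract grid ([folklore]). -/

/-- FIBRE AVERAGING: if every fibre of the key map `π` through a point of `C` has exactly `n ≥ 1` elements of `C` and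
carries `g`-weight at most `B`, then `Σ_{c ∈ C} g c ≤ (#C/n)·B`. [folklore] -/
theorem sum_le_of_fibres {γ κ : Type*} [DecidableEq κ] (C : Finset γ) (π : γ → κ) (g : γ → ℝ) {n : ℕ}
    (hn : 0 < n) {B : ℝ} (hcard : ∀ c ∈ C, (C.filter fun c' => π c' = π c).card = n)
    (hfib : ∀ c ∈ C, ∑ c' ∈ C.filter (fun c' => π c' = π c), g c' ≤ B) :
    ∑ c ∈ C, g c ≤ (C.card / n) * B := by
  have hmaps : ∀ c ∈ C, π c ∈ C.image π := fun c hc => mem_image_of_mem π hc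
  have hkey : ∀ k ∈ C.image π, ∃ c ∈ C, π c = k := fun k hk => mem_image.mp hk
  have h' : ∀ k ∈ C.image π, (C.filter fun c' => π c' = k).card = n := by
    intro k hk
    obtain ⟨c, hc, rfl⟩ := hkey k hk
    exact hcard c hc
  have hB : ∀ k ∈ C.image π, ∑ c' ∈ C.filter (fun c' => π c' = k), g c' ≤ B := by
    intro k hk
    obtain ⟨c, hc, rfl⟩ := hkey k hk
    exact hfib c hc
  have hcardC : C.card = (C.image π).card * n := by
    calc C.card = ∑ k ∈ C.image π, (C.filter fun c' => π c' = k).card := card_eq_sum_card_fiberwise hmaps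
      _ = ∑ _k ∈ C.image π, n := sum_congr rfl h'
      _ = (C.image π).card * n := by rw [sum_const, smul_eq_mul]
  have hn' : (n : ℝ) ≠ 0 := Nat.cast_ne_zero.mpr hn.ne'
  calc ∑ c ∈ C, g c = ∑ k ∈ C.image π, ∑ c' ∈ C.filter (fun c' => π c' = k), g c' :=
        (sum_fiberwise_of_maps_to hmaps g).symm
    _ ≤ ∑ _k ∈ C.image π, B := sum_le_sum hB
    _ = (C.image π).card * B := by rw [sum_const, nsmul_eq_mul]
    _ = (C.card / n) * B := by rw [hcardC, Nat.cast_mul, mul_div_cancel_right₀ _ hn']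

/-- **JOINT CHOICE BY FIBRE AVERAGING.**  On a nonempty finite set `C` with, for every level `l ∈ J`, a key map `π l`
whose fibres through points of `C` have exactly `n l ≥ 1` elements and carry `g l`-weight at most `B l`, some point
`c ∈ C` has `Σ_{l ∈ J} g l c ≤ Σ_{l ∈ J} B l / n l`. [folklore] -/
theorem exists_joint_choice_of_fibres {γ Λ κ : Type*} [DecidableEq κ] (C : Finset γ) (hC : C.Nonempty)
    (J : Finset Λ) (π : Λ → γ → κ) (g : Λ → γ → ℝ) (n : Λ → ℕ) (B : Λ → ℝ) (hn : ∀ l ∈ J, 0 < n l)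
    (hcard : ∀ l ∈ J, ∀ c ∈ C, (C.filter fun c' => π l c' = π l c).card = n l)
    (hfib : ∀ l ∈ J, ∀ c ∈ C, ∑ c' ∈ C.filter (fun c' => π l c' = π l c), g l c' ≤ B l) :
    ∃ c ∈ C, ∑ l ∈ J, g l c ≤ ∑ l ∈ J, B l / n l := by
  refine exists_le_of_sum_le hC ?_
  calc ∑ c ∈ C, ∑ l ∈ J, g l c = ∑ l ∈ J, ∑ c ∈ C, g l c := sum_comm
    _ ≤ ∑ l ∈ J, (C.card / n l) * B l :=
        sum_le_sum fun l hl => sum_le_of_fibres C (π l) (g l) (hn l hl) (hcard l hl) (hfib l hl)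
    _ = C.card * ∑ l ∈ J, B l / n l := by
        rw [mul_sum]
        exact sum_congr rfl fun l _ => by ring
    _ = ∑ _c ∈ C, ∑ l ∈ J, B l / n l := by rw [sum_const, nsmul_eq_mul]

/-- the CANDIDATE GRID of joint threshold-index assignments over the live levels `Λ`: `c : Λ → ℕ` with `c l < n l`
for every `l`. [folklore] -/
def candGrid {Λ : Type*} [DecidableEq Λ] [Fintype Λ] (n : Λ → ℕ) : Finset (Λ → ℕ) :=
  Fintype.piFinset fun l => range (n l)

/-- membership in the candidate grid. [folklore] -/
@[simp] theorem mem_candGrid {Λ : Type*} [DecidableEq Λ] [Fintype Λ] {n : Λ → ℕ} {c : Λ → ℕ} :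
    c ∈ candGrid n ↔ ∀ l, c l < n l := by
  simp [candGrid, Fintype.mem_piFinset]

/-- the candidate grid is nonempty as soon as every level has a candidate. [folklore] -/
theorem candGrid_nonempty {Λ : Type*} [DecidableEq Λ] [Fintype Λ] {n : Λ → ℕ} (hn : ∀ l, 0 < n l) :
    (candGrid n).Nonempty :=
  ⟨fun _ => 0, mem_candGrid.mpr hn⟩

/-- THE FIBRE ALONG ONE COORDINATE: the assignments of the grid agreeing with `c` off level `l` are exactly the
`update c l m`, `m < n l`. [folklore] -/
theorem filter_candGrid_update_eq {Λ : Type*} [DecidableEq Λ] [Fintype Λ] (n : Λ → ℕ) (l : Λ) {c : Λ → ℕ}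
    (hc : c ∈ candGrid n) :
    (candGrid n).filter (fun c' => Function.update c' l 0 = Function.update c l 0)
      = (range (n l)).image (Function.update c l) := by
  ext c'
  simp only [mem_filter, mem_image, mem_range, mem_candGrid]
  constructor
  · rintro ⟨hc', heq⟩
    refine ⟨c' l, hc' l, ?_⟩
    have key : Function.update (Function.update c l 0) l (c' l)
        = Function.update (Function.update c' l 0) l (c' l) := by rw [heq]
    rw [Function.update_idem, Function.update_idem, Function.update_eq_self] at key
    exact key
  · rintro ⟨m, hm, rfl⟩
    refine ⟨fun l' => ?_, Function.update_idem _ _ _⟩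
    rcases eq_or_ne l' l with rfl | hne
    · simpa using hm
    · rw [Function.update_of_ne hne]
      exact (mem_candGrid.mp hc) l'

/-- … so every coordinate fibre has exactly `n l` elements … [folklore] -/
theorem card_filter_candGrid_update {Λ : Type*} [DecidableEq Λ] [Fintype Λ] (n : Λ → ℕ) (l : Λ) {c : Λ → ℕ}
    (hc : c ∈ candGrid n) :
    ((candGrid n).filter fun c' => Function.update c' l 0 = Function.update c l 0).card = n l := by
  rw [filter_candGrid_update_eq n l hc, card_image_of_injective _ (Function.update_injective c l), card_range]

/-- … and a sum over it is the sum over the own coordinate. [folklore] -/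
theorem sum_filter_candGrid_update {Λ : Type*} [DecidableEq Λ] [Fintype Λ] (n : Λ → ℕ) (l : Λ) {c : Λ → ℕ}
    (hc : c ∈ candGrid n) (g : (Λ → ℕ) → ℝ) :
    ∑ c' ∈ (candGrid n).filter (fun c' => Function.update c' l 0 = Function.update c l 0), g c'
      = ∑ m ∈ range (n l), g (Function.update c l m) := by
  rw [filter_candGrid_update_eq n l hc, sum_image fun x _ y _ h => Function.update_injective c l h]

/-- **THE JOINT TWO-RUN PIGEONHOLE OVER THE LIVE WINDOW** (grounding (δ), all live levels at once; answers advisory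
A2).  Slots `S l` per live level, candidate-weight functions `fA l s c, fB l s c ≥ 0` of the WHOLE assignment `c`, and
OWN-COORDINATE DISJOINTNESS: for every frozen assignment the `n l` candidate weights of a slot along its own level sum
to at most the run's total weight `ZA`, `ZB > 0`.  Then SOME assignment of the grid makes, in BOTH runs at once, the
shell weight summed over all live levels at most `(Σ_l 2ν_l/n_l) ×` the total weight, `ν_l = #(S l)`. [folklore] -/
theorem exists_joint_common_threshold {Λ σ : Type*} [DecidableEq Λ] [Fintype Λ] (n : Λ → ℕ) (hn : ∀ l, 0 < n l)
    (S : Λ → Finset σ) (fA fB : Λ → σ → (Λ → ℕ) → ℝ) {ZA ZB : ℝ} (hZA : 0 < ZA) (hZB : 0 < ZB)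
    (hA0 : ∀ l, ∀ s ∈ S l, ∀ c, 0 ≤ fA l s c) (hB0 : ∀ l, ∀ s ∈ S l, ∀ c, 0 ≤ fB l s c)
    (hA : ∀ l, ∀ s ∈ S l, ∀ c ∈ candGrid n, ∑ m ∈ range (n l), fA l s (Function.update c l m) ≤ ZA)
    (hB : ∀ l, ∀ s ∈ S l, ∀ c ∈ candGrid n, ∑ m ∈ range (n l), fB l s (Function.update c l m) ≤ ZB) :
    ∃ c ∈ candGrid n,
      ∑ l, ∑ s ∈ S l, fA l s c ≤ (∑ l, 2 * ((S l).card : ℝ) / n l) * ZA ∧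
      ∑ l, ∑ s ∈ S l, fB l s c ≤ (∑ l, 2 * ((S l).card : ℝ) / n l) * ZB := by
  set g : Λ → (Λ → ℕ) → ℝ := fun l c => (∑ s ∈ S l, fA l s c) / ZA + (∑ s ∈ S l, fB l s c) / ZB with hg
  have hfib : ∀ l ∈ (univ : Finset Λ), ∀ c ∈ candGrid n,
      ∑ c' ∈ (candGrid n).filter (fun c' => Function.update c' l 0 = Function.update c l 0), g l c'
        ≤ 2 * ((S l).card : ℝ) := by
    intro l _ c hc
    rw [sum_filter_candGrid_update n l hc]
    have h1 : ∑ m ∈ range (n l), (∑ s ∈ S l, fA l s (Function.update c l m)) / ZA ≤ (S l).card := by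
      rw [← sum_div, div_le_iff₀ hZA]
      exact sum_candidates_le_card_mul (S l) (n l) (fun s m => fA l s (Function.update c l m))
        fun s hs => hA l s hs c hc
    have h2 : ∑ m ∈ range (n l), (∑ s ∈ S l, fB l s (Function.update c l m)) / ZB ≤ (S l).card := by
      rw [← sum_div, div_le_iff₀ hZB]
      exact sum_candidates_le_card_mul (S l) (n l) (fun s m => fB l s (Function.update c l m))
        fun s hs => hB l s hs c hc
    simp only [hg, sum_add_distrib]
    linarith
  obtain ⟨c, hc, hle⟩ := exists_joint_choice_of_fibres (candGrid n) (candGrid_nonempty hn) univ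
    (fun l c => Function.update c l 0) g n (fun l => 2 * ((S l).card : ℝ)) (fun l _ => hn l)
    (fun l _ c hc => card_filter_candGrid_update n l hc) hfib
  have hAq : ∑ l, (∑ s ∈ S l, fA l s c) / ZA ≤ ∑ l, 2 * ((S l).card : ℝ) / n l := by
    refine le_trans (sum_le_sum fun l _ => ?_) hle
    have h0 : 0 ≤ (∑ s ∈ S l, fB l s c) / ZB := div_nonneg (sum_nonneg fun s hs => hB0 l s hs c) hZB.le
    simp only [hg]
    linarith
  have hBq : ∑ l, (∑ s ∈ S l, fB l s c) / ZB ≤ ∑ l, 2 * ((S l).card : ℝ) / n l := by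
    refine le_trans (sum_le_sum fun l _ => ?_) hle
    have h0 : 0 ≤ (∑ s ∈ S l, fA l s c) / ZA := div_nonneg (sum_nonneg fun s hs => hA0 l s hs c) hZA.le
    simp only [hg]
    linarith
  refine ⟨c, hc, ?_, ?_⟩
  · rw [← sum_div, div_le_iff₀ hZA] at hAq
    exact hAq
  · rw [← sum_div, div_le_iff₀ hZB] at hBq
    exact hBq

/-- **CANDIDATE COUNT.**  With `n = ⌊β′/ρ⌋₊` candidates of relative spacing `ρ ≤ β′/2`: `n ≥ 1`, the candidates fit
under the slack (`nρ ≤ β′`) and the pigeonhole gain is linear in `ρ`: `2/n ≤ (4/β′)·ρ`. [folklore] -/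
theorem candidateCount_spec {β' ρ : ℝ} (hρ : 0 < ρ) (h2 : 2 * ρ ≤ β') :
    0 < ⌊β' / ρ⌋₊ ∧ (⌊β' / ρ⌋₊ : ℝ) * ρ ≤ β' ∧ (2 : ℝ) / ⌊β' / ρ⌋₊ ≤ (4 / β') * ρ := by
  have hβ : 0 < β' := by linarith
  have hx : 2 ≤ β' / ρ := by rw [le_div_iff₀ hρ]; linarith
  have hfl : 0 < ⌊β' / ρ⌋₊ := Nat.floor_pos.mpr (by linarith)
  have hflR : (0 : ℝ) < ⌊β' / ρ⌋₊ := by exact_mod_cast hfl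
  refine ⟨hfl, ?_, ?_⟩
  · exact (le_div_iff₀ hρ).mp (Nat.floor_le (by positivity))
  · have k1 : β' / ρ - 1 < ⌊β' / ρ⌋₊ := by linarith [Nat.lt_floor_add_one (β' / ρ)]
    have k2 : (β' / ρ - 1) * ρ < ⌊β' / ρ⌋₊ * ρ := mul_lt_mul_of_pos_right k1 hρ
    have k3 : (β' / ρ - 1) * ρ = β' - ρ := by
      rw [sub_mul, one_mul, div_mul_cancel₀ β' hρ.ne']
    rw [div_le_iff₀ hflR, show (4 : ℝ) / β' * ρ * ⌊β' / ρ⌋₊ = (4 * ρ * ⌊β' / ρ⌋₊) / β' by ring,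
      le_div_iff₀ hβ]
    linarith

/-- … and then every candidate shell lies inside the printed slack window `[θ(1 − β′), θ)`. [folklore] -/
theorem candShell_subset_slack {θ ρ β' : ℝ} (hθ : 0 ≤ θ) (hρ0 : 0 ≤ ρ) (hρ1 : ρ ≤ 1) {i n : ℕ} (hi : i < n)
    (hnρ : (n : ℝ) * ρ ≤ β') : candShell θ ρ i ⊆ Set.Ico (θ * (1 - β')) θ := by
  refine (candShell_subset_window hθ hρ0 hρ1 hi).trans (Set.Ico_subset_Ico ?_ le_rfl)
  exact mul_le_mul_of_nonneg_left (by linarith) hθ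

/-- THE LEVEL FRACTION UNDER THE RATE FORM: `ν ≤ ν̄` slots, `2/n ≤ D̄ρ` (candidate count) and `ρ ≤ c₁x`
(`x = ϑ^{K−a}`, node U1b) give `2ν/n ≤ (ν̄D̄c₁)·x`. [folklore] -/
theorem levelFraction_le_of_rate {ν n ρ νbar Dbar c₁ x : ℝ} (hνbar : 0 ≤ νbar) (hDbar : 0 ≤ Dbar)
    (hν : ν ≤ νbar) (hn : 0 < n) (hnρ : 2 / n ≤ Dbar * ρ) (hρ : ρ ≤ c₁ * x) :
    2 * ν / n ≤ (νbar * Dbar * c₁) * x := by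
  have h2n : 0 ≤ 2 / n := by positivity
  calc 2 * ν / n = ν * (2 / n) := by ring
    _ ≤ νbar * (Dbar * ρ) := mul_le_mul hν hnρ h2n hνbar
    _ ≤ νbar * (Dbar * (c₁ * x)) := by gcongr
    _ = (νbar * Dbar * c₁) * x := by ring

/-- THE AGE SUM IS GEOMETRIC IN `K`: over the ages `a ≤ N₁` of the bounded live window, terms `≤ M·ϑ^{K−a}` sum to
`≤ (N₁ + 1)Mϑ^{−N₁}·ϑ^K` (`0 < ϑ ≤ 1`; `K − a` is truncated subtraction, harmless for `K < a`). [folklore] -/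
theorem ageSum_le_geometric (K N₁ : ℕ) (x : Fin (N₁ + 1) → ℝ) {M ϑ : ℝ} (hϑ0 : 0 < ϑ) (hϑ1 : ϑ ≤ 1)
    (hM : 0 ≤ M) (hx : ∀ a, x a ≤ M * ϑ ^ (K - (a : ℕ))) :
    ∑ a, x a ≤ ((N₁ + 1) * M * ϑ⁻¹ ^ N₁) * ϑ ^ K := by
  have hpow : ∀ a : Fin (N₁ + 1), ϑ ^ (K - (a : ℕ)) ≤ ϑ⁻¹ ^ N₁ * ϑ ^ K := by
    intro a
    have ha : (a : ℕ) ≤ N₁ := Nat.lt_succ_iff.mp a.isLt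
    have h1 : ϑ ^ (K - (a : ℕ) + N₁) ≤ ϑ ^ K := pow_le_pow_of_le_one hϑ0.le hϑ1 (by omega)
    have h2 : ϑ ^ (K - (a : ℕ)) = ϑ⁻¹ ^ N₁ * ϑ ^ (K - (a : ℕ) + N₁) := by
      rw [pow_add, inv_pow, mul_comm, mul_assoc, mul_inv_cancel₀ (pow_ne_zero _ hϑ0.ne'), mul_one]
    rw [h2]
    exact mul_le_mul_of_nonneg_left h1 (by positivity)
  calc ∑ a, x a ≤ ∑ _a : Fin (N₁ + 1), M * (ϑ⁻¹ ^ N₁ * ϑ ^ K) :=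
        sum_le_sum fun a _ => (hx a).trans (mul_le_mul_of_nonneg_left (hpow a) hM)
    _ = ((N₁ + 1) * M * ϑ⁻¹ ^ N₁) * ϑ ^ K := by
        rw [sum_const, card_univ, Fintype.card_fin, nsmul_eq_mul]
        push_cast
        ring

/-- **THE CHOICE FUNCTION** (the joint pigeonhole for every `K`, packaged).  Per number of steps `K`: candidate counts
`n K a ≥ 1` and slots `S K a` per age `a ∈ Fin (N₁ + 1)` (level `j = K − a` of the bounded live window), candidate
weights `fA K a s c, fB K a s c ≥ 0` with own-coordinate disjointness against the totals `ZA K, ZB K > 0`, and level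
fractions `2ν/n ≤ M·ϑ^{K−a}` (`levelFraction_le_of_rate`; empty ages contribute `0`).  Then there is ONE assignment
`c⋆ K` per `K` making both runs' shell weights, summed over the window, `≤ ((N₁ + 1)Mϑ^{−N₁})·ϑ^K ×` the totals — the
input `hqA`/`hqB` of `shellWeightBound_of_realized` after flattening the slots of all ages (`Finset.univ.sigma (S K)`,
`Finset.sum_sigma`). [folklore] -/
theorem exists_threshold_choice_function {σ : Type*} (N₁ : ℕ) (n : ℕ → Fin (N₁ + 1) → ℕ)
    (hn : ∀ K a, 0 < n K a) (S : ℕ → Fin (N₁ + 1) → Finset σ)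
    (fA fB : ℕ → Fin (N₁ + 1) → σ → (Fin (N₁ + 1) → ℕ) → ℝ) (ZA ZB : ℕ → ℝ)
    (hZA : ∀ K, 0 < ZA K) (hZB : ∀ K, 0 < ZB K)
    (hA0 : ∀ K a, ∀ s ∈ S K a, ∀ c, 0 ≤ fA K a s c) (hB0 : ∀ K a, ∀ s ∈ S K a, ∀ c, 0 ≤ fB K a s c)
    (hA : ∀ K a, ∀ s ∈ S K a, ∀ c ∈ candGrid (n K),
      ∑ m ∈ range (n K a), fA K a s (Function.update c a m) ≤ ZA K)
    (hB : ∀ K a, ∀ s ∈ S K a, ∀ c ∈ candGrid (n K),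
      ∑ m ∈ range (n K a), fB K a s (Function.update c a m) ≤ ZB K)
    {M ϑ : ℝ} (hϑ0 : 0 < ϑ) (hϑ1 : ϑ ≤ 1) (hM : 0 ≤ M)
    (hlev : ∀ K a, 2 * ((S K a).card : ℝ) / n K a ≤ M * ϑ ^ (K - (a : ℕ))) :
    ∃ cstar : ℕ → (Fin (N₁ + 1) → ℕ), ∀ K, cstar K ∈ candGrid (n K) ∧
      ∑ a, ∑ s ∈ S K a, fA K a s (cstar K) ≤ ((((N₁ : ℝ) + 1) * M * ϑ⁻¹ ^ N₁) * ϑ ^ K) * ZA K ∧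
      ∑ a, ∑ s ∈ S K a, fB K a s (cstar K) ≤ ((((N₁ : ℝ) + 1) * M * ϑ⁻¹ ^ N₁) * ϑ ^ K) * ZB K := by
  have hK : ∀ K, ∃ c ∈ candGrid (n K),
      ∑ a, ∑ s ∈ S K a, fA K a s c ≤ ((((N₁ : ℝ) + 1) * M * ϑ⁻¹ ^ N₁) * ϑ ^ K) * ZA K ∧
      ∑ a, ∑ s ∈ S K a, fB K a s c ≤ ((((N₁ : ℝ) + 1) * M * ϑ⁻¹ ^ N₁) * ϑ ^ K) * ZB K := by
    intro K
    obtain ⟨c, hc, hAK, hBK⟩ := exists_joint_common_threshold (n K) (hn K) (S K) (fA K) (fB K) (hZA K)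
      (hZB K) (hA0 K) (hB0 K) (hA K) (hB K)
    have hq : ∑ a, 2 * ((S K a).card : ℝ) / n K a ≤ (((N₁ : ℝ) + 1) * M * ϑ⁻¹ ^ N₁) * ϑ ^ K :=
      ageSum_le_geometric K N₁ (fun a => 2 * ((S K a).card : ℝ) / n K a) hϑ0 hϑ1 hM (hlev K)
    exact ⟨c, hc, hAK.trans (mul_le_mul_of_nonneg_right hq (hZA K).le),
      hBK.trans (mul_le_mul_of_nonneg_right hq (hZB K).le)⟩
  exact ⟨fun K => (hK K).choose, fun K => (hK K).choose_spec⟩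

/-- **THE REALIZED LEDGER** of a run written with the chosen thresholds: per-slot constant `c K s = e^{2a} ×` (realized
shell fraction of slot `s` at source `t = 0`), where `|t·source| ≤ a` pointwise gives the two tilt inequalities
(pieces at `t` `≤ e^a ×` pieces at `0`; total at `0` `≤ e^a ×` total at `t`).  Its `slot` field is
`ratio_transfer_of_tilt`; no anti-concentration hypothesis is left — it has been CONSUMED by the choice. [folklore] -/
theorem SlotLedger.of_realized {ι σ : Type*} {l₀ a : ℝ} {T : ℕ → Finset ι} {A sh : ℕ → ℝ → ι → ℝ}
    {S : ℕ → Finset σ} {piece : ℕ → ℝ → σ → ι → ℝ}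
    (sh_nonneg : ∀ K t, |t| ≤ l₀ → ∀ τ ∈ T K, 0 ≤ sh K t τ)
    (sh_le : ∀ K t, |t| ≤ l₀ → ∀ τ ∈ T K, sh K t τ ≤ A K t τ)
    (cover : ∀ K t, |t| ≤ l₀ → ∀ τ ∈ T K, sh K t τ ≤ ∑ s ∈ S K, piece K t s τ)
    (piece_nonneg : ∀ K, ∀ s ∈ S K, ∀ τ ∈ T K, 0 ≤ piece K 0 s τ)
    (hZ0 : ∀ K, 0 < ∑ τ ∈ T K, A K 0 τ)
    (tiltS : ∀ K t, |t| ≤ l₀ → ∀ s ∈ S K,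
      ∑ τ ∈ T K, piece K t s τ ≤ Real.exp a * ∑ τ ∈ T K, piece K 0 s τ)
    (tiltZ : ∀ K t, |t| ≤ l₀ → ∑ τ ∈ T K, A K 0 τ ≤ Real.exp a * ∑ τ ∈ T K, A K t τ) :
    SlotLedger l₀ T A sh S piece
      (fun K s => Real.exp (2 * a) * ((∑ τ ∈ T K, piece K 0 s τ) / ∑ τ ∈ T K, A K 0 τ)) where
  sh_nonneg := sh_nonneg
  sh_le := sh_le
  cover := cover
  slot K t ht s hs := by
    have hq : 0 ≤ (∑ τ ∈ T K, piece K 0 s τ) / ∑ τ ∈ T K, A K 0 τ :=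
      div_nonneg (sum_nonneg (piece_nonneg K s hs)) (hZ0 K).le
    exact ratio_transfer_of_tilt (tiltS K t ht s hs) (tiltZ K t ht)
      (div_mul_cancel₀ _ (hZ0 K).ne').symm.le hq
  c_nonneg K s hs :=
    mul_nonneg (Real.exp_pos _).le (div_nonneg (sum_nonneg (piece_nonneg K s hs)) (hZ0 K).le)

/-- the relative shell weight of a realized ledger is `e^{2a} ×` the realized total shell fraction at `t = 0`; a bound
`q` on the latter (the chosen assignment's, `exists_threshold_choice_function`) bounds `ω K ≤ e^{2a}q`. [folklore] -/
theorem SlotLedger.omega_of_realized_le {ι σ : Type*} {l₀ a : ℝ} {T : ℕ → Finset ι} {A sh : ℕ → ℝ → ι → ℝ}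
    {S : ℕ → Finset σ} {piece : ℕ → ℝ → σ → ι → ℝ}
    (h : SlotLedger l₀ T A sh S piece
      (fun K s => Real.exp (2 * a) * ((∑ τ ∈ T K, piece K 0 s τ) / ∑ τ ∈ T K, A K 0 τ)))
    (K : ℕ) (hZ0 : 0 < ∑ τ ∈ T K, A K 0 τ) {q : ℝ}
    (hq : ∑ s ∈ S K, ∑ τ ∈ T K, piece K 0 s τ ≤ q * ∑ τ ∈ T K, A K 0 τ) :
    h.omega K ≤ Real.exp (2 * a) * q := by
  simp only [SlotLedger.omega]
  rw [← mul_sum, ← sum_div]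
  refine mul_le_mul_of_nonneg_left ?_ (Real.exp_pos _).le
  rwa [div_le_iff₀ hZ0]

/-- **THE CONSTRUCTOR FOR GROUNDING (δ), END TO END.**  Two realized ledgers (the two runs of the `K`-th comparison,
both written with the chosen assignment `c⋆ K`) whose realized shell fractions at `t = 0` are `≤ C·ϑ^K`
(`exists_threshold_choice_function`) give `T4IndicatorShell.ShellWeightBound l₀ T A B shA shB Wsh` with
`Wsh K = ω^A K + ω^B K ≤ 2e^{2a}C·ϑ^K` — summable, eventually small (`eventually_omega_add_lt`). [folklore] -/
theorem shellWeightBound_of_realized {ι σ σ' : Type*} {l₀ a C ϑ : ℝ} {T : ℕ → Finset ι}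
    {A B shA shB : ℕ → ℝ → ι → ℝ} {SA : ℕ → Finset σ} {SB : ℕ → Finset σ'}
    {pieceA : ℕ → ℝ → σ → ι → ℝ} {pieceB : ℕ → ℝ → σ' → ι → ℝ}
    (hA : SlotLedger l₀ T A shA SA pieceA
      (fun K s => Real.exp (2 * a) * ((∑ τ ∈ T K, pieceA K 0 s τ) / ∑ τ ∈ T K, A K 0 τ)))
    (hB : SlotLedger l₀ T B shB SB pieceB
      (fun K s => Real.exp (2 * a) * ((∑ τ ∈ T K, pieceB K 0 s τ) / ∑ τ ∈ T K, B K 0 τ)))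
    (hZA : ∀ K, 0 < ∑ τ ∈ T K, A K 0 τ) (hZB : ∀ K, 0 < ∑ τ ∈ T K, B K 0 τ)
    (hϑ0 : 0 ≤ ϑ) (hϑ1 : ϑ < 1)
    (hqA : ∀ K, ∑ s ∈ SA K, ∑ τ ∈ T K, pieceA K 0 s τ ≤ (C * ϑ ^ K) * ∑ τ ∈ T K, A K 0 τ)
    (hqB : ∀ K, ∑ s ∈ SB K, ∑ τ ∈ T K, pieceB K 0 s τ ≤ (C * ϑ ^ K) * ∑ τ ∈ T K, B K 0 τ) :
    T4IndicatorShell.ShellWeightBound l₀ T A B shA shB (fun K => hA.omega K + hB.omega K) :=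
  shellWeightBound_of_slotLedger hA hB hϑ0 hϑ1 (C := Real.exp (2 * a) * C)
    (fun K => by simpa only [mul_assoc] using hA.omega_of_realized_le K (hZA K) (hqA K))
    (fun K => by simpa only [mul_assoc] using hB.omega_of_realized_le K (hZB K) (hqB K))


/-! ## §8 The live common threshold factor (v4): flip indices, cascade count, decision-tree positivity, ordered windows

Dictionary (READING (R), located — the integrated form of §7's (L2); nothing below asserts it).  At `K` steps and
source `t` let `μ_{K,t} ≥ 0` be the run's threshold-free positive measure on the space `X` of configurations.  The
expansion B14 (2.18) — *"where the summation is over the admissible sequences of domains."* (p. 257), the operation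
being *"a composition of integrations restricted to large field regions in successive scales, and multiplications by
characteristic functions, δ-functions defining renormalization transformations, and gauge fixing expressions."*
(pp. 257–258) — is generated by successive SHARP decompositions of unity inserted conditionally on what has been
decided before: B15 p. 181 *"More precisely, we introduce this decomposition in each component of Z separately."*,
p. 182 *"In this integral we introduce the decomposition of unity 1 = χ_k^{(n+1)} + (1 − χ_k^{(n+1)}) for each
component of Z, and we exclude from Z the components with the large field functions 1 − χ_k^{(n+1)}."*, p. 183 *"Let
us notice that all the characteristic functions introduced above depend on the field variables localized in the
corresponding components of the large field region Z_k. This is an important part of the inductive assumption for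
the effective density, more precisely for the operation 𝕋_k(Z_k)."*  Read at a configuration `x`, the terms `τ` are
the LEAVES of a DECISION TREE: its STAGES `σ` (a step and a kind of condition) insert, given the OLDER PATH (the
outcomes already decided, which determine the current regions and components), finitely many THRESHOLD TESTS
`u < Θ` of variables `u = u(x; older path)` (a characteristic function with several conditions is ONE test of the
normalised maximum); the integrated term weights are `A K t τ = μ_{K,t}(𝟙_τ)` with `Σ_τ 𝟙_τ ≡ 1`, and a term's shell
part is carried by its own leaf on the event "some booked test of the path has its variable in its own shell"
(`T4IndicatorShell.shellPiece_mul_le_shell_mul_term`; shells BELOW the threshold for small-field slots, ABOVE for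
large-field slots, `T4IndicatorShell.shellBelow` / `shellAbove`).  The compared quantities across `K` are the
integrals, B15 p. 193 *"the equivalence means that both sides have equal integrals over the space of fields"*.

THE LIVE COMMON FACTOR (member (δ-1)).  Candidate index `i < n`: the threshold of EVERY booked test (the
background-mediated slots of the live window, (W1)) is multiplied by ONE common factor `λ_i = (1 − ρ⋆)^i`, `ρ⋆ :=`
twice the largest live closeness radius; every other test is left unchanged (it is candidate-independent given the
older path and is absorbed into the outcome maps `LiveStage.next`, or into the dead prefix `a₀` if decided before
the first live stage).  A booked test is MONOTONE in `i`, so it reads small exactly below a FLIP INDEX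
(`exists_flipIndex_threshold`); its own shell at candidate `i` (relative width `ρ ≤ ρ⋆/2`) lies in the `i`-th
candidate shell if below, in the `(i−1)`-st if above (`ownShell_subset_candShell`, `aboveShell_subset_candShell`),
hence it can carry shell weight at candidate `i` only if its flip index is `i + 1` resp. `i` — a HIT
(`flipIndex_eq_of_mem_candShell`, `flipIndex_eq_of_mem_aboveShell`, `flipIndex_eq_zero_of_le`).  THE CASCADE COUNT
(`jumps`, `LiveStage`, `livePaths`, `sum_hits₂_livePaths_le`), pointwise in `x` and whatever the dependence of the
tests on the older path: on a stretch of candidate indices where the older path is constant each test of a stage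
flips at most once, and a jump of the path after the stage needs a flipping test; so through `S` live stages
inserting at most `ν_σ` booked tests each (given the older path) the hits number at most `2(∏_σ (ν_σ + 1) − 1)` IN
TOTAL over all `n` candidates.  Integrating — superadditivity of the lower Lebesgue integral, no measurability needed
(`sum_lintegral_le_lintegral_sum`, `sum_lintegral_le_of_pointwise`, `sum_le_cascade_of_hits`,
`candidateTotals_le_of_pointwise`) — each run's candidate-summed shell totals are `≤ V·Z`, `V = 2(∏_σ(ν_σ + 1) − 1)`,
`Z = μ_{K,0}(X)` the common total weight of all candidate expansions; the two-run pigeonhole FROM TOTALS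
(`exists_common_index_of_totals`) and the candidate count `n_K = ⌊β′/ρ⋆_K⌋₊` (`candidateCount_spec`, rate
`ρ⋆_K ≤ 2c₁ϑ^{K−N₁}`) give one index `i⋆_K` per `K` with BOTH runs' realized shell totals `≤ (V·M)ϑ^K ×` their total
weights (`exists_liveFactor_choice_function`), and §7's realized ledgers conclude (`shellWeightBound_of_liveFactor`:
`T4IndicatorShell.ShellWeightBound` BY NAME for the two runs written with `λ_{i⋆_K}`, `Wsh K ≤ 2e^{2a}(V·M)ϑ^K`).
What this member needs of the expansion is ONLY the reading (R) and the per-stage count (W1): §7's own-coordinate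
disjointness hypotheses `hA`/`hB` (input (L2a)) do not occur.  Its price is the constant `V` (a product over the
live stages instead of §7's sum; `K`-independent on the bounded window, so harmless for summability, but the start of
the comparison window moves by `≈ S·log(ν̄ + 1)/log(1/ϑ)` steps).  Its gain on the robustness side: ONE common factor
leaves every printed RELATION BETWEEN LIVE THRESHOLDS exactly invariant (ratios unchanged — the ladders B15
(1.22)–(1.24), whose index counts the internal integrations of one step, and every implication of the type B15 p. 183
*"Now we will prove that the restrictions introduced by the new characteristic functions imply that the functions
(1.3), (1.4), (1.5), (1.7), (1.8), χ_k^{(n)} are equal to 1."* inside the window), so the located input (L1) shrinks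
to (L1-step): robustness of the single-run bounds CONSUMED DOWNSTREAM (not by this constructor) under ONE common
lowering `λ ∈ [1 − β′, 1]` of all live thresholds.  Census of the printed comparisons between a scaled and an
unscaled quantity (companion record §3): implications "new (scaled) ⇒ inherited (unscaled)" and every «sufficiently
small» analyticity condition GAIN room; the ONLY loss is in the large-field suppression exponents, which acquire the
factor `λ² ≥ (1 − β′)²` — and there the margin is printed as a STRICT inequality between powers of `log g_j^{−2}`,
B16 p. 383 *"This is the largest factor among all the small factors we have obtained from the large field
characteristic functions in the preparatory steps. We assume that 2p₁ − (d + 5)r₀ > p₀, and we estimate the factors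
by exp(−p₀(g_j))."* (a constant `λ²` in the exponent `R_j^{−d−5}p₁²(g_j)` is absorbed for `g_j` sufficiently small,
depending on `β′`; B15 p. 182 *"We choose the number β satisfying 0 < β ≤ 1/2, but not too small, e.g., we can take
β = 1/2."*).  The completeness of that census over B14–B16 is the reading (L1-step) — NOT PRINTED as a uniformity
statement: the manuscripts fix their thresholds once.

DECISION-TREE POSITIVITY (member (δ-stages) = §7 with coordinates = STAGES).  Under (R), §7's hypotheses `hA`/`hB`
hold when its coordinates are taken to be the live STAGES (not the levels: two tests of one level inserted at
different stages are on each other's older path): with the other stages' candidates frozen, the older path, the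
eligibility of a stage-`σ` slot and its tested variable do not depend on the stage's own candidate index `m`, the
younger outcomes are summed out first, and the candidate shells are disjoint (`sum_indicator_twoSidedShell_le_one`,
`2ρ ≤ ρ⋆`), so `Σ_m (weight: slot tested, variable in the m-th shell) ≤ μ(X)` — `tree_ownShell_sum_le` is the
measure-level form (older weights `Q_h`, `Σ_h Q_h ≤ 1`, candidate-independent; younger-and-current weights
`R_{h h'}^{(m)}`, `Σ_{h'} ≤ 1` for every `m`; any `u_h`), `ownShell_hyp_of_tree` the real-valued form of `hA`/`hB`
(`exists_threshold_choice_function` is then used with `Fin S` in place of `Fin (N₁ + 1)`, stages enumerated age-major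
so that a stage's index is at least its age and the rate hypothesis `hlev` survives).  ORDERED NESTED WINDOWS
(`stage_candShell_subset_window`, `stage_threshold_antitone`, `total_slack_of_stages`): giving stage `σ` the base
factor `(1 − β″)^σ`, `β″ = β′/S`, puts all its candidates in `[θ(1 − β″)^{σ+1}, θ(1 − β″)^σ)`, so every assignment of
the grid is ORDERED (younger thresholds carry smaller factors) and every "new ⇒ inherited" implication between live
stages gains room as well; the robustness census of this member, (L1-ordered), is (L1-step) plus the printed
same-step relations between thresholds of different kinds (room of size `R_k`, e.g. B15 p. 193), and its constants
are §7's: shell fraction `≤ Σ_σ 2ν_σ/n_σ ≤ (4S ν̄/β″)·ρ⋆_K`.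

LOCATED, NOT PRINTED (the inputs of both members, named; none is asserted here): (R) the decision-tree reading above;
(W1) at most `ν̄` booked tests per live stage and older path and `S` live stages, both `K`-independent (cell analysis,
companion record); the rate `ρ⋆_K ≤ 2c₁ϑ^{K−N₁}` (node U1b); (L1-step) resp. (L1-ordered), consumed by the OTHER
single-run bounds of the `K`-th comparison, which are run with the chosen convention.  NOT PRINTED anywhere in
B14/B15/B16 (renders and held text searched): any variation of the thresholds after they are fixed, any uniformity
of the inductive bounds under a common or ordered lowering of the live thresholds, any count of threshold flips.
Everything below is finite combinatorics of sequences, elementary real inequalities and positivity of the lower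
Lebesgue integral over an abstract measure space ([folklore]). -/

/-! ### the cascade count (pointwise combinatorics of flips along the candidate factors) -/

section Cascade

variable {α τ : Type*} [DecidableEq α]

/-- the JUMP INDICES of a sequence `q` inside `range n`: the `i` with `i + 1 < n` and `q (i + 1) ≠ q i`. [folklore] -/
def jumps (q : ℕ → α) (n : ℕ) : Finset ℕ := (range n).filter fun i => i + 1 < n ∧ q (i + 1) ≠ q i

/-- the jump set grows with the range. [folklore] -/
theorem jumps_mono (q : ℕ → α) {n n' : ℕ} (h : n ≤ n') : jumps q n ⊆ jumps q n' := by
  intro i hi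
  simp only [jumps, mem_filter, mem_range] at hi ⊢
  exact ⟨by omega, by omega, hi.2.2⟩

/-- a sequence takes at most `#jumps + 1` distinct values on `range n`. [folklore] -/
theorem card_image_le_card_jumps_succ (q : ℕ → α) (n : ℕ) :
    ((range n).image q).card ≤ (jumps q n).card + 1 := by
  induction n with
  | zero => simp
  | succ n ih =>
    rw [range_add_one, image_insert]
    by_cases hmem : q n ∈ (range n).image q
    · rw [insert_eq_of_mem hmem]
      exact ih.trans (Nat.add_le_add_right (card_le_card (jumps_mono q (Nat.le_succ n))) 1)
    · rw [card_insert_of_notMem hmem]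
      rcases Nat.eq_zero_or_pos n with rfl | hn
      · simp
      · have hne : q n ≠ q (n - 1) := by
          intro h
          exact hmem (mem_image.mpr ⟨n - 1, mem_range.mpr (by omega), h.symm⟩)
        have hnew : n - 1 ∈ jumps q (n + 1) := by
          simp only [jumps, mem_filter, mem_range]
          refine ⟨by omega, by omega, ?_⟩
          rw [Nat.sub_add_cancel hn]
          exact hne
        have hnot : n - 1 ∉ jumps q n := by
          simp only [jumps, mem_filter, mem_range, not_and]
          intro _ h2
          omega
        have hss : insert (n - 1) (jumps q n) ⊆ jumps q (n + 1) :=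
          insert_subset hnew (jumps_mono q (Nat.le_succ n))
        have := card_le_card hss
        rw [card_insert_of_notMem hnot] at this
        omega

/-- ONE LIVE STAGE of the decision tree, read at a fixed field configuration: given the value `a` of the OLDER path,
the finite set `tests a` of threshold tests inserted at this stage, the FLIP INDEX `flip a t` of each (the test reads
SMALL at candidate index `i` iff `i < flip a t` — the booked thresholds carry the common decreasing factor `λ_i`;
candidate-independent tests decided at the stage are part of `next`), and the deterministic outcome map `next a S`
(new path value from the old one and the set `S` of booked tests reading small). [folklore] -/
structure LiveStage (α τ : Type*) where
  /-- tests inserted at this stage, given the older path -/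
  tests : α → Finset τ
  /-- flip index of a test, given the older path -/
  flip : α → τ → ℕ
  /-- outcome map: older path value and the set of small tests ↦ new path value -/
  next : α → Finset τ → α

/-- the path AFTER the stage as a function of the candidate index, from the older path `q`. [folklore] -/
def LiveStage.path (st : LiveStage α τ) (q : ℕ → α) (i : ℕ) : α :=
  st.next (q i) ((st.tests (q i)).filter fun t => i < st.flip (q i) t)

/-- SHELL HITS at candidate index `i`: tests of the stage whose flip index is exactly `i + 1` (small at `i`, large at
`i + 1` — the only indices at which the tested variable can lie in the `i`-th candidate shell). [folklore] -/
def LiveStage.hits (st : LiveStage α τ) (q : ℕ → α) (i : ℕ) : ℕ :=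
  ((st.tests (q i)).filter fun t => st.flip (q i) t = i + 1).card

/-- SHELL HITS ABOVE at candidate index `i`: tests whose flip index is exactly `i` (large already at `i`, small at
`i − 1` — the only indices at which the tested variable can lie just ABOVE the `i`-th candidate threshold, where the
large-field slots' shells `T4IndicatorShell.shellAbove` sit). [folklore] -/
def LiveStage.hitsAbove (st : LiveStage α τ) (q : ℕ → α) (i : ℕ) : ℕ :=
  ((st.tests (q i)).filter fun t => st.flip (q i) t = i).card

/-- the (older value, test) pairs available along `range n` number at most `(#jumps + 1)·ν`. [folklore] -/
theorem card_sigma_tests_le (st : LiveStage α τ) (q : ℕ → α) (n ν : ℕ) (hν : ∀ a, (st.tests a).card ≤ ν) :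
    (((range n).image q).sigma st.tests).card ≤ ((jumps q n).card + 1) * ν := by
  rw [card_sigma]
  calc ∑ a ∈ (range n).image q, (st.tests a).card ≤ ∑ _a ∈ (range n).image q, ν := sum_le_sum fun a _ => hν a
    _ = ((range n).image q).card * ν := by rw [sum_const, smul_eq_mul]
    _ ≤ ((jumps q n).card + 1) * ν := Nat.mul_le_mul_right ν (card_image_le_card_jumps_succ q n)

/-- **HITS PER STAGE**: along `range n` a stage scores at most `ν·(#jumps of the older path + 1)` shell hits — on a
stretch of constant older path every test flips at most once. [folklore] -/
theorem LiveStage.sum_hits_le (st : LiveStage α τ) (q : ℕ → α) (n ν : ℕ) (hν : ∀ a, (st.tests a).card ≤ ν) :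
    ∑ i ∈ range n, st.hits q i ≤ ν * ((jumps q n).card + 1) := by
  classical
  have hcard : ∑ i ∈ range n, st.hits q i
      = ((range n).sigma fun i => (st.tests (q i)).filter fun t => st.flip (q i) t = i + 1).card := by
    rw [card_sigma]; rfl
  rw [hcard, mul_comm]
  refine le_trans ?_ (card_sigma_tests_le st q n ν hν)
  refine card_le_card_of_injOn (fun x => ⟨q x.1, x.2⟩) ?_ ?_
  · intro x hx
    simp only [coe_sigma, Set.mem_sigma_iff, mem_coe, mem_range, mem_filter] at hx
    simp only [coe_sigma, Set.mem_sigma_iff, mem_coe, mem_image, mem_range]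
    exact ⟨⟨x.1, hx.1, rfl⟩, hx.2.1⟩
  · rintro ⟨i, t⟩ hx ⟨i', t'⟩ hx' h
    simp only [coe_sigma, Set.mem_sigma_iff, mem_coe, mem_range, mem_filter] at hx hx'
    simp only [Sigma.mk.injEq] at h
    obtain ⟨hq, ht⟩ := h
    have htt : t = t' := eq_of_heq ht
    subst htt
    have : i = i' := by
      have h1 := hx.2.2
      have h2 := hx'.2.2
      rw [hq] at h1
      omega
    subst this
    rfl

/-- … and at most `ν·(#jumps + 1)` shell hits above. [folklore] -/
theorem LiveStage.sum_hitsAbove_le (st : LiveStage α τ) (q : ℕ → α) (n ν : ℕ) (hν : ∀ a, (st.tests a).card ≤ ν) :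
    ∑ i ∈ range n, st.hitsAbove q i ≤ ν * ((jumps q n).card + 1) := by
  classical
  have hcard : ∑ i ∈ range n, st.hitsAbove q i
      = ((range n).sigma fun i => (st.tests (q i)).filter fun t => st.flip (q i) t = i).card := by
    rw [card_sigma]; rfl
  rw [hcard, mul_comm]
  refine le_trans ?_ (card_sigma_tests_le st q n ν hν)
  refine card_le_card_of_injOn (fun x => ⟨q x.1, x.2⟩) ?_ ?_
  · intro x hx
    simp only [coe_sigma, Set.mem_sigma_iff, mem_coe, mem_range, mem_filter] at hx
    simp only [coe_sigma, Set.mem_sigma_iff, mem_coe, mem_image, mem_range]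
    exact ⟨⟨x.1, hx.1, rfl⟩, hx.2.1⟩
  · rintro ⟨i, t⟩ hx ⟨i', t'⟩ hx' h
    simp only [coe_sigma, Set.mem_sigma_iff, mem_coe, mem_range, mem_filter] at hx hx'
    simp only [Sigma.mk.injEq] at h
    obtain ⟨hq, ht⟩ := h
    have htt : t = t' := eq_of_heq ht
    subst htt
    have : i = i' := by
      have h1 := hx.2.2
      have h2 := hx'.2.2
      rw [hq] at h1
      omega
    subst this
    rfl

/-- **JUMPS PER STAGE**: the path after the stage jumps at most `#jumps(older) + ν·(#jumps(older) + 1)` times along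
`range n` — a new jump at constant older path needs a flipping test. [folklore] -/
theorem LiveStage.card_jumps_path_le (st : LiveStage α τ) (q : ℕ → α) (n ν : ℕ)
    (hν : ∀ a, (st.tests a).card ≤ ν) :
    (jumps (st.path q) n).card ≤ (jumps q n).card + ν * ((jumps q n).card + 1) := by
  classical
  set J := jumps (st.path q) n with hJ
  have hsplit := card_filter_add_card_filter_not (s := J) (fun i => q (i + 1) ≠ q i)
  have h1 : (J.filter fun i => q (i + 1) ≠ q i).card ≤ (jumps q n).card := by
    refine card_le_card ?_
    intro i hi
    simp only [hJ, jumps, mem_filter, mem_range] at hi ⊢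
    exact ⟨hi.1.1, hi.1.2.1, hi.2⟩
  have h2 : (J.filter fun i => ¬ q (i + 1) ≠ q i).card ≤ ν * ((jumps q n).card + 1) := by
    -- such an index is `flip a t - 1` for an available pair (a, t)
    set g : (Σ _ : α, τ) → ℕ := fun x => st.flip x.1 x.2 - 1 with hg
    have hsub : (J.filter fun i => ¬ q (i + 1) ≠ q i) ⊆ (((range n).image q).sigma st.tests).image g := by
      intro i hi
      simp only [mem_filter, not_not, hJ, jumps, mem_range] at hi
      obtain ⟨⟨hin, hi1n, hne⟩, hqq⟩ := hi
      simp only [LiveStage.path, hqq] at hne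
      -- the two filtered sets differ
      have hsets : ((st.tests (q i)).filter fun t => i + 1 < st.flip (q i) t)
          ≠ ((st.tests (q i)).filter fun t => i < st.flip (q i) t) := fun h => hne (by rw [h])
      obtain ⟨t, ht⟩ : ∃ t, ¬ (t ∈ ((st.tests (q i)).filter fun t => i + 1 < st.flip (q i) t) ↔
          t ∈ ((st.tests (q i)).filter fun t => i < st.flip (q i) t)) := by
        by_contra hall
        push Not at hall
        exact hsets (Finset.ext hall)
      rw [mem_filter, mem_filter] at ht
      have htm : t ∈ st.tests (q i) := by
        by_contra hn
        exact ht (by simp [hn])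
      have hflip : st.flip (q i) t = i + 1 := by
        simp only [htm, true_and] at ht
        omega
      refine mem_image.mpr ⟨⟨q i, t⟩, ?_, ?_⟩
      · simp only [mem_sigma, mem_image, mem_range]
        exact ⟨⟨i, hin, rfl⟩, htm⟩
      · simp only [hg, hflip]; rfl
    calc (J.filter fun i => ¬ q (i + 1) ≠ q i).card ≤ ((((range n).image q).sigma st.tests).image g).card :=
          card_le_card hsub
      _ ≤ (((range n).image q).sigma st.tests).card := card_image_le
      _ ≤ ((jumps q n).card + 1) * ν := card_sigma_tests_le st q n ν hν
      _ = ν * ((jumps q n).card + 1) := mul_comm _ _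
  omega

/-- the PATHS of the decision tree through `S` live stages, from the (candidate-independent) dead prefix `a₀`.
[folklore] -/
def livePaths (st : ℕ → LiveStage α τ) (a₀ : α) : ℕ → ℕ → α
  | 0 => fun _ => a₀
  | σ + 1 => (st σ).path (livePaths st a₀ σ)

/-- the dead prefix is candidate-independent: no jumps before the first live stage. [folklore] -/
theorem jumps_livePaths_zero (st : ℕ → LiveStage α τ) (a₀ : α) (n : ℕ) : jumps (livePaths st a₀ 0) n = ∅ := by
  simp [jumps, livePaths]

/-- jumps of the path through `σ` live stages: `#jumps + 1 ≤ ∏_{τ<σ} (ν_τ + 1)`. [folklore] -/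
theorem card_jumps_livePaths_le (st : ℕ → LiveStage α τ) (a₀ : α) (n : ℕ) (ν : ℕ → ℕ)
    (hν : ∀ σ a, ((st σ).tests a).card ≤ ν σ) (σ : ℕ) :
    (jumps (livePaths st a₀ σ) n).card + 1 ≤ ∏ τ ∈ range σ, (ν τ + 1) := by
  induction σ with
  | zero => simp [jumps_livePaths_zero]
  | succ σ ih =>
    have h := (st σ).card_jumps_path_le (livePaths st a₀ σ) n (ν σ) (hν σ)
    rw [prod_range_succ]
    calc (jumps (livePaths st a₀ (σ + 1)) n).card + 1
        ≤ ((jumps (livePaths st a₀ σ) n).card + 1) * (ν σ + 1) := by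
          simp only [livePaths]; nlinarith [h]
      _ ≤ (∏ τ ∈ range σ, (ν τ + 1)) * (ν σ + 1) := Nat.mul_le_mul_right _ ih

/-- **THE CASCADE COUNT** (pointwise, per field configuration): along the `n` candidate indices the live stages score
in total at most `∏_σ (ν_σ + 1) − 1` shell hits. [folklore] -/
theorem sum_hits_livePaths_le (st : ℕ → LiveStage α τ) (a₀ : α) (n : ℕ) (ν : ℕ → ℕ)
    (hν : ∀ σ a, ((st σ).tests a).card ≤ ν σ) (S : ℕ) :
    (∑ σ ∈ range S, ∑ i ∈ range n, (st σ).hits (livePaths st a₀ σ) i) + 1 ≤ ∏ σ ∈ range S, (ν σ + 1) := by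
  induction S with
  | zero => simp
  | succ S ih =>
    rw [sum_range_succ, prod_range_succ]
    have hh := (st S).sum_hits_le (livePaths st a₀ S) n (ν S) (hν S)
    have hj := card_jumps_livePaths_le st a₀ n ν hν S
    calc ∑ σ ∈ range S, ∑ i ∈ range n, (st σ).hits (livePaths st a₀ σ) i
          + ∑ i ∈ range n, (st S).hits (livePaths st a₀ S) i + 1
        ≤ (∏ σ ∈ range S, (ν σ + 1) - 1) + ν S * (∏ σ ∈ range S, (ν σ + 1)) + 1 := by
          have h1 : ∑ σ ∈ range S, ∑ i ∈ range n, (st σ).hits (livePaths st a₀ σ) i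
              ≤ ∏ σ ∈ range S, (ν σ + 1) - 1 := by omega
          have h2 : ∑ i ∈ range n, (st S).hits (livePaths st a₀ S) i ≤ ν S * ∏ σ ∈ range S, (ν σ + 1) :=
            hh.trans (Nat.mul_le_mul_left _ hj)
          omega
      _ = (∏ σ ∈ range S, (ν σ + 1)) * (ν S + 1) := by
          have hpos : 1 ≤ ∏ σ ∈ range S, (ν σ + 1) := le_trans (by omega) hj
          zify [hpos]
          ring

/-- **THE CASCADE COUNT, TWO-SIDED** (hits below and above the candidate thresholds): in total at most
`2·(∏_σ (ν_σ + 1) − 1)`. [folklore] -/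
theorem sum_hits₂_livePaths_le (st : ℕ → LiveStage α τ) (a₀ : α) (n : ℕ) (ν : ℕ → ℕ)
    (hν : ∀ σ a, ((st σ).tests a).card ≤ ν σ) (S : ℕ) :
    (∑ σ ∈ range S, ∑ i ∈ range n,
        ((st σ).hits (livePaths st a₀ σ) i + (st σ).hitsAbove (livePaths st a₀ σ) i)) + 2
      ≤ 2 * ∏ σ ∈ range S, (ν σ + 1) := by
  induction S with
  | zero => simp
  | succ S ih =>
    rw [sum_range_succ, prod_range_succ]
    have hj := card_jumps_livePaths_le st a₀ n ν hν S
    have hh : ∑ i ∈ range n, ((st S).hits (livePaths st a₀ S) i + (st S).hitsAbove (livePaths st a₀ S) i)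
        ≤ 2 * (ν S * ∏ σ ∈ range S, (ν σ + 1)) := by
      rw [sum_add_distrib]
      have h1 := ((st S).sum_hits_le (livePaths st a₀ S) n (ν S) (hν S)).trans (Nat.mul_le_mul_left _ hj)
      have h2 := ((st S).sum_hitsAbove_le (livePaths st a₀ S) n (ν S) (hν S)).trans (Nat.mul_le_mul_left _ hj)
      omega
    have hpos : 1 ≤ ∏ σ ∈ range S, (ν σ + 1) := le_trans (by omega) hj
    nlinarith [ih, hh, hpos]

end Cascade


/-! ### monotone threshold tests have a flip index -/

/-- A DOWNWARD-CLOSED test along the candidate indices `0, …, n` reads SMALL exactly below a FLIP INDEX `φ`.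
[folklore] -/
theorem exists_flipIndex (p : ℕ → Prop) [DecidablePred p] (hdown : ∀ i j, i ≤ j → p j → p i) (n : ℕ) :
    ∃ φ : ℕ, φ ≤ n + 1 ∧ ∀ i ≤ n, (p i ↔ i < φ) := by
  set A := (range (n + 1)).filter p with hA
  refine ⟨A.card, ?_, fun i hi => ⟨fun hpi => ?_, fun hlt => ?_⟩⟩
  · calc A.card ≤ (range (n + 1)).card := card_filter_le _ _
      _ = n + 1 := card_range _
  · -- `range (i+1) ⊆ A`
    have hsub : range (i + 1) ⊆ A := by
      intro j hj
      simp only [hA, mem_filter, mem_range] at hj ⊢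
      exact ⟨by omega, hdown j i (by omega) hpi⟩
    have := card_le_card hsub
    rw [card_range] at this
    omega
  · by_contra hpi
    -- `A ⊆ range i`
    have hsub : A ⊆ range i := by
      intro j hj
      simp only [hA, mem_filter, mem_range] at hj ⊢
      by_contra hji
      exact hpi (hdown i j (by omega) hj.2)
    have := card_le_card hsub
    rw [card_range] at this
    omega

/-- the threshold test `u < θ·c^i` with the COMMON FACTOR `λ_i = c^i`, `0 ≤ c ≤ 1`, `0 ≤ θ`, is downward closed in
`i`. [folklore] -/
theorem thresholdTest_downward {u θ c : ℝ} (hθ : 0 ≤ θ) (hc0 : 0 ≤ c) (hc1 : c ≤ 1) :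
    ∀ i j : ℕ, i ≤ j → u < θ * c ^ j → u < θ * c ^ i := by
  intro i j hij hu
  exact lt_of_lt_of_le hu (mul_le_mul_of_nonneg_left (pow_le_pow_of_le_one hc0 hc1 hij) hθ)

/-- … hence has a flip index `φ ≤ n + 1`: for `i ≤ n`, `u < θc^i ↔ i < φ`. [folklore] -/
theorem exists_flipIndex_threshold {u θ c : ℝ} (hθ : 0 ≤ θ) (hc0 : 0 ≤ c) (hc1 : c ≤ 1) (n : ℕ) :
    ∃ φ : ℕ, φ ≤ n + 1 ∧ ∀ i ≤ n, (u < θ * c ^ i ↔ i < φ) := by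
  classical
  exact exists_flipIndex (fun i => u < θ * c ^ i) (thresholdTest_downward hθ hc0 hc1) n

/-- A slot's OWN shell of relative width `ρ ≤ ρ⋆` below the common candidate threshold `θ(1 − ρ⋆)^i` lies inside the
`i`-th candidate shell of width `ρ⋆` (`0 ≤ θ`, `ρ⋆ ≤ 1`). [folklore] -/
theorem ownShell_subset_candShell {θ ρ ρstar : ℝ} (hθ : 0 ≤ θ) (hle : ρ ≤ ρstar) (h1 : ρstar ≤ 1) (i : ℕ) :
    Set.Ico (θ * (1 - ρstar) ^ i * (1 - ρ)) (θ * (1 - ρstar) ^ i) ⊆ candShell θ ρstar i := by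
  intro x hx
  simp only [Set.mem_Ico, candShell] at hx ⊢
  refine ⟨le_trans ?_ hx.1, hx.2⟩
  have h0 : 0 ≤ θ * (1 - ρstar) ^ i := mul_nonneg hθ (pow_nonneg (by linarith) _)
  calc θ * (1 - ρstar) ^ (i + 1) = θ * (1 - ρstar) ^ i * (1 - ρstar) := by ring
    _ ≤ θ * (1 - ρstar) ^ i * (1 - ρ) := mul_le_mul_of_nonneg_left (by linarith) h0

/-- IN THE CANDIDATE SHELL ⇒ THE FLIP INDEX IS `i + 1`: a tested value in the `i`-th candidate shell reads small at
`i` and large at `i + 1` (`i + 1 ≤ n`). [folklore] -/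
theorem flipIndex_eq_of_mem_candShell {u θ ρstar : ℝ} {n φ i : ℕ} (hφ : ∀ i ≤ n, (u < θ * (1 - ρstar) ^ i ↔ i < φ))
    (hi : i + 1 ≤ n) (hu : u ∈ candShell θ ρstar i) : φ = i + 1 := by
  simp only [candShell, Set.mem_Ico] at hu
  have h1 : i < φ := (hφ i (by omega)).mp hu.2
  have h2 : ¬ (i + 1 < φ) := fun h => absurd ((hφ (i + 1) hi).mpr h) (not_lt.mpr hu.1)
  omega

/-- A large-field slot's OWN shell of relative width `ρ ≤ ρ⋆` ABOVE the `(i+1)`-st candidate threshold lies inside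
the `i`-th candidate shell (`0 ≤ θ`, `0 ≤ ρ`, `ρ⋆ ≤ 1`). [folklore] -/
theorem aboveShell_subset_candShell {θ ρ ρstar : ℝ} (hθ : 0 ≤ θ) (h0 : 0 ≤ ρ) (hle : ρ ≤ ρstar) (h1 : ρstar ≤ 1)
    (i : ℕ) :
    Set.Ico (θ * (1 - ρstar) ^ (i + 1)) (θ * (1 - ρstar) ^ (i + 1) * (1 + ρ)) ⊆ candShell θ ρstar i := by
  intro x hx
  simp only [Set.mem_Ico, candShell] at hx ⊢
  refine ⟨hx.1, lt_of_lt_of_le hx.2 ?_⟩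
  have h0' : 0 ≤ θ * (1 - ρstar) ^ i := mul_nonneg hθ (pow_nonneg (by linarith) _)
  calc θ * (1 - ρstar) ^ (i + 1) * (1 + ρ) = θ * (1 - ρstar) ^ i * ((1 - ρstar) * (1 + ρ)) := by ring
    _ ≤ θ * (1 - ρstar) ^ i * 1 := mul_le_mul_of_nonneg_left (by nlinarith) h0'
    _ = θ * (1 - ρstar) ^ i := mul_one _

/-- AT OR ABOVE THE TOP THRESHOLD ⇒ THE FLIP INDEX IS `0`. [folklore] -/
theorem flipIndex_eq_zero_of_le {u θ c : ℝ} {n φ : ℕ} (hφ : ∀ i ≤ n, (u < θ * c ^ i ↔ i < φ)) (hu : θ ≤ u) :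
    φ = 0 := by
  have h := hφ 0 (Nat.zero_le _)
  rw [pow_zero, mul_one] at h
  have : ¬ (0 < φ) := fun hlt => absurd (h.mpr hlt) (not_lt.mpr hu)
  omega

/-- IN THE SHELL ABOVE the `(i+1)`-st candidate threshold ⇒ the flip index is `i + 1` (`i + 1 ≤ n`): the test is a
hit-above at candidate `i + 1`. [folklore] -/
theorem flipIndex_eq_of_mem_aboveShell {u θ ρ ρstar : ℝ} {n φ i : ℕ} (hθ : 0 ≤ θ) (h0 : 0 ≤ ρ) (hle : ρ ≤ ρstar)
    (h1 : ρstar ≤ 1) (hφ : ∀ i ≤ n, (u < θ * (1 - ρstar) ^ i ↔ i < φ)) (hi : i + 1 ≤ n)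
    (hu : u ∈ Set.Ico (θ * (1 - ρstar) ^ (i + 1)) (θ * (1 - ρstar) ^ (i + 1) * (1 + ρ))) : φ = i + 1 :=
  flipIndex_eq_of_mem_candShell hφ hi (aboveShell_subset_candShell hθ h0 hle h1 i hu)

/-! ### ordered nested windows (the §7 member with coordinates = stages) -/

/-- **ORDERED NESTED WINDOWS.**  With the STAGE BASE FACTOR `(1 − β″)^σ` (`0 ≤ β″ ≤ 1`) and `n` candidates of
relative spacing `ρ` with `nρ ≤ β″`, every candidate shell of stage `σ` lies in the window
`[θ(1 − β″)^{σ+1}, θ(1 − β″)^σ)`: the windows of distinct stages are disjoint and ORDERED — whatever candidates are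
chosen, every threshold factor of a younger stage is below every threshold factor of an older one. [folklore] -/
theorem stage_candShell_subset_window {θ β'' ρ : ℝ} (hθ : 0 ≤ θ) (hβ1 : β'' ≤ 1) (hρ0 : 0 ≤ ρ) (hρ1 : ρ ≤ 1)
    {i n : ℕ} (hi : i < n) (hnρ : (n : ℝ) * ρ ≤ β'') (σ : ℕ) :
    candShell (θ * (1 - β'') ^ σ) ρ i ⊆ Set.Ico (θ * (1 - β'') ^ (σ + 1)) (θ * (1 - β'') ^ σ) := by
  have hθσ : 0 ≤ θ * (1 - β'') ^ σ := mul_nonneg hθ (pow_nonneg (by linarith) _)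
  have h := candShell_subset_slack hθσ hρ0 hρ1 hi hnρ
  have heq : θ * (1 - β'') ^ σ * (1 - β'') = θ * (1 - β'') ^ (σ + 1) := by ring
  rwa [heq] at h

/-- … the stage windows are ordered: for `σ < σ'` the top of window `σ'` is at most the bottom of window `σ`.
[folklore] -/
theorem stage_threshold_antitone {θ β'' : ℝ} (hθ : 0 ≤ θ) (hβ0 : 0 ≤ β'') (hβ1 : β'' ≤ 1) {σ σ' : ℕ}
    (h : σ < σ') : θ * (1 - β'') ^ σ' ≤ θ * (1 - β'') ^ (σ + 1) :=
  mul_le_mul_of_nonneg_left (pow_le_pow_of_le_one (by linarith) (by linarith) h) hθ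

/-- … and `S` stages fit under the total slack `Sβ″` (Bernoulli): `θ(1 − Sβ″) ≤ θ(1 − β″)^S`. [folklore] -/
theorem total_slack_of_stages {θ β'' : ℝ} (hθ : 0 ≤ θ) (hβ1 : β'' ≤ 1) (S : ℕ) :
    θ * (1 - S * β'') ≤ θ * (1 - β'') ^ S := by
  refine mul_le_mul_of_nonneg_left ?_ hθ
  have hb : 1 + (S : ℝ) * (-β'') ≤ (1 + (-β'')) ^ S := one_add_mul_le_pow (by linarith) S
  calc 1 - (S : ℝ) * β'' = 1 + S * (-β'') := by ring
    _ ≤ (1 + (-β'')) ^ S := hb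
    _ = (1 - β'') ^ S := by ring

/-! ### decision-tree positivity at measure level (the structural discharge of own-shell disjointness) -/

/-- superadditivity of the lower Lebesgue integral over a finite sum (no measurability needed). [folklore] -/
theorem sum_lintegral_le_lintegral_sum {X : Type*} [MeasurableSpace X] {μ : Measure X} {ι : Type*}
    (s : Finset ι) (f : ι → X → ℝ≥0∞) :
    ∑ i ∈ s, ∫⁻ x, f i x ∂μ ≤ ∫⁻ x, ∑ i ∈ s, f i x ∂μ := by
  classical
  induction s using Finset.induction_on with
  | empty => simp
  | insert a s ha ih =>
    rw [sum_insert ha]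
    calc ∫⁻ x, f a x ∂μ + ∑ i ∈ s, ∫⁻ x, f i x ∂μ
        ≤ ∫⁻ x, f a x ∂μ + ∫⁻ x, ∑ i ∈ s, f i x ∂μ := add_le_add le_rfl ih
      _ ≤ ∫⁻ x, f a x + ∑ i ∈ s, f i x ∂μ := le_lintegral_add _ _
      _ = ∫⁻ x, ∑ i ∈ insert a s, f i x ∂μ := by simp only [sum_insert ha]

/-- a pairwise disjoint family of events: its indicators sum to at most `1` at every point. [folklore] -/
theorem sum_indicator_le_one_of_disjoint (E : ℕ → Set ℝ) (s : Finset ℕ)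
    (hE : ∀ m ∈ s, ∀ m' ∈ s, m ≠ m' → Disjoint (E m) (E m')) (y : ℝ) :
    ∑ m ∈ s, (E m).indicator (fun _ => (1 : ℝ≥0∞)) y ≤ 1 := by
  classical
  by_cases h : ∃ m ∈ s, y ∈ E m
  · obtain ⟨m₀, hm₀, hy⟩ := h
    rw [← add_sum_erase _ _ hm₀, Set.indicator_of_mem hy]
    have hrest : ∑ m ∈ s.erase m₀, (E m).indicator (fun _ => (1 : ℝ≥0∞)) y = 0 := by
      refine sum_eq_zero fun m hm => ?_
      rw [Set.indicator_of_notMem]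
      intro hy'
      have hne : m ≠ m₀ := (mem_erase.mp hm).1
      exact Set.disjoint_left.mp (hE m (mem_of_mem_erase hm) m₀ hm₀ hne) hy' hy
    rw [hrest, add_zero]
  · push Not at h
    rw [sum_eq_zero fun m hm => Set.indicator_of_notMem (h m hm) _]
    exact zero_le_one

/-- the TWO-SIDED SHELL of relative half-width `ρ` around the `i`-th candidate threshold `θ(1 − ρ⋆)^i` (below: the
small-field slots' `shellBelow`; above: the large-field slots' `shellAbove`). [folklore] -/
def twoSidedShell (θ ρstar ρ : ℝ) (i : ℕ) : Set ℝ :=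
  Set.Ico (θ * (1 - ρstar) ^ i * (1 - ρ)) (θ * (1 - ρstar) ^ i * (1 + ρ))

/-- two-sided shells of distinct candidates are disjoint when the candidate spacing is at least twice the shell
width (`2ρ ≤ ρ⋆ ≤ 1`), ordered case. [folklore] -/
theorem twoSidedShell_disjoint_of_lt {θ ρstar ρ : ℝ} (hθ : 0 ≤ θ) (h0 : 0 ≤ ρ) (h2 : 2 * ρ ≤ ρstar)
    (h1 : ρstar ≤ 1) {i i' : ℕ} (h : i < i') : Disjoint (twoSidedShell θ ρstar ρ i) (twoSidedShell θ ρstar ρ i') := by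
  rw [Set.disjoint_left]
  intro x hx hx'
  simp only [twoSidedShell, Set.mem_Ico] at hx hx'
  have hpow : (1 - ρstar) ^ i' ≤ (1 - ρstar) ^ (i + 1) := pow_le_pow_of_le_one (by linarith) (by linarith) h
  have hq : 0 ≤ (1 - ρstar) ^ i := pow_nonneg (by linarith) _
  have hkey : θ * (1 - ρstar) ^ i' * (1 + ρ) ≤ θ * (1 - ρstar) ^ i * (1 - ρ) := by
    calc θ * (1 - ρstar) ^ i' * (1 + ρ) ≤ θ * (1 - ρstar) ^ (i + 1) * (1 + ρ) :=
          mul_le_mul_of_nonneg_right (mul_le_mul_of_nonneg_left hpow hθ) (by linarith)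
      _ = θ * (1 - ρstar) ^ i * ((1 - ρstar) * (1 + ρ)) := by ring
      _ ≤ θ * (1 - ρstar) ^ i * (1 - ρ) := mul_le_mul_of_nonneg_left (by nlinarith) (mul_nonneg hθ hq)
  linarith [hx.1, hx'.2]

/-- two-sided shells of distinct candidates are disjoint when `2ρ ≤ ρ⋆ ≤ 1`, `0 ≤ ρ`, `0 ≤ θ`. [folklore] -/
theorem twoSidedShell_disjoint {θ ρstar ρ : ℝ} (hθ : 0 ≤ θ) (h0 : 0 ≤ ρ) (h2 : 2 * ρ ≤ ρstar) (h1 : ρstar ≤ 1)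
    {i i' : ℕ} (h : i ≠ i') : Disjoint (twoSidedShell θ ρstar ρ i) (twoSidedShell θ ρstar ρ i') := by
  rcases Nat.lt_or_gt_of_ne h with hlt | hgt
  · exact twoSidedShell_disjoint_of_lt hθ h0 h2 h1 hlt
  · exact (twoSidedShell_disjoint_of_lt hθ h0 h2 h1 hgt).symm

/-- … hence their indicators sum to at most `1` (the hypothesis `hE` of `tree_ownShell_sum_le` for two-sided slot
shells). [folklore] -/
theorem sum_indicator_twoSidedShell_le_one {θ ρstar ρ : ℝ} (hθ : 0 ≤ θ) (h0 : 0 ≤ ρ) (h2 : 2 * ρ ≤ ρstar)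
    (h1 : ρstar ≤ 1) (s : Finset ℕ) (y : ℝ) :
    ∑ m ∈ s, (twoSidedShell θ ρstar ρ m).indicator (fun _ => (1 : ℝ≥0∞)) y ≤ 1 :=
  sum_indicator_le_one_of_disjoint _ s (fun _ _ _ _ hne => twoSidedShell_disjoint hθ h0 h2 h1 hne) y

/-- pairwise disjoint candidate shells: the indicators of the first `n` sum to at most `1` at every point. [folklore] -/
theorem sum_indicator_candShell_le_one {θ ρ : ℝ} (hθ : 0 ≤ θ) (hρ0 : 0 ≤ ρ) (hρ1 : ρ ≤ 1) (n : ℕ) (y : ℝ) :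
    ∑ m ∈ range n, (candShell θ ρ m).indicator (fun _ => (1 : ℝ≥0∞)) y ≤ 1 :=
  sum_indicator_le_one_of_disjoint _ _ (fun _ _ _ _ hne => candShell_disjoint hθ hρ0 hρ1 hne) y

/-- **DECISION-TREE POSITIVITY** (the measure-level discharge of the own-coordinate hypotheses `hA`/`hB` of §7's
`exists_joint_common_threshold`).  Older paths `h ∈ P` with nonnegative indicator weights `Q h` summing to `≤ 1`
pointwise (FROZEN: independent of the candidate index `m` of the stage), younger-and-current weights `R h h' m`
summing over `h' ∈ P'` to `≤ 1` pointwise for every `m`, a tested variable `u h` given the older path, and pairwise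
disjoint candidate events `E m` (indicators summing to `≤ 1`): the weights of the terms in which the slot is tested
(`h ∈ tested ⊆ P`) and its variable lies in the `m`-th event, summed over `m`, do not exceed the total mass.
[folklore] -/
theorem tree_ownShell_sum_le {X : Type*} [MeasurableSpace X] (μ : Measure X) {H H' : Type*}
    (P : Finset H) (P' : Finset H') (Q : H → X → ℝ≥0∞) (hQ : ∀ x, ∑ h ∈ P, Q h x ≤ 1) {n : ℕ}
    (R : H → H' → ℕ → X → ℝ≥0∞) (hR : ∀ h ∈ P, ∀ m ∈ range n, ∀ x, ∑ h' ∈ P', R h h' m x ≤ 1)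
    (u : H → X → ℝ) (E : ℕ → Set ℝ) (hE : ∀ y, ∑ m ∈ range n, (E m).indicator (fun _ => (1 : ℝ≥0∞)) y ≤ 1)
    (tested : Finset H) (ht : tested ⊆ P) :
    ∑ m ∈ range n, ∑ h ∈ tested, ∑ h' ∈ P',
        ∫⁻ x, Q h x * R h h' m x * (E m).indicator (fun _ => (1 : ℝ≥0∞)) (u h x) ∂μ ≤ μ Set.univ := by
  classical
  -- sum out the younger stages
  have step1 : ∀ m ∈ range n, ∀ h ∈ P,
      ∑ h' ∈ P', ∫⁻ x, Q h x * R h h' m x * (E m).indicator (fun _ => (1 : ℝ≥0∞)) (u h x) ∂μ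
        ≤ ∫⁻ x, Q h x * (E m).indicator (fun _ => (1 : ℝ≥0∞)) (u h x) ∂μ := by
    intro m hm h hh
    refine (sum_lintegral_le_lintegral_sum _ _).trans (lintegral_mono fun x => ?_)
    have hfac : ∑ h' ∈ P', Q h x * R h h' m x * (E m).indicator (fun _ => (1 : ℝ≥0∞)) (u h x)
        = (Q h x * (E m).indicator (fun _ => (1 : ℝ≥0∞)) (u h x)) * ∑ h' ∈ P', R h h' m x := by
      rw [mul_sum]
      refine sum_congr rfl fun h' _ => ?_
      ring
    rw [hfac]
    calc (Q h x * (E m).indicator (fun _ => (1 : ℝ≥0∞)) (u h x)) * ∑ h' ∈ P', R h h' m x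
        ≤ (Q h x * (E m).indicator (fun _ => (1 : ℝ≥0∞)) (u h x)) * 1 :=
          mul_le_mul' le_rfl (hR h hh m hm x)
      _ = Q h x * (E m).indicator (fun _ => (1 : ℝ≥0∞)) (u h x) := mul_one _
  calc ∑ m ∈ range n, ∑ h ∈ tested, ∑ h' ∈ P',
          ∫⁻ x, Q h x * R h h' m x * (E m).indicator (fun _ => (1 : ℝ≥0∞)) (u h x) ∂μ
      ≤ ∑ m ∈ range n, ∑ h ∈ P, ∑ h' ∈ P',
          ∫⁻ x, Q h x * R h h' m x * (E m).indicator (fun _ => (1 : ℝ≥0∞)) (u h x) ∂μ :=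
        sum_le_sum fun m _ => sum_le_sum_of_subset ht
    _ ≤ ∑ m ∈ range n, ∑ h ∈ P, ∫⁻ x, Q h x * (E m).indicator (fun _ => (1 : ℝ≥0∞)) (u h x) ∂μ :=
        sum_le_sum fun m hm => sum_le_sum fun h hh => step1 m hm h hh
    _ = ∑ h ∈ P, ∑ m ∈ range n, ∫⁻ x, Q h x * (E m).indicator (fun _ => (1 : ℝ≥0∞)) (u h x) ∂μ := sum_comm
    _ ≤ ∑ h ∈ P, ∫⁻ x, ∑ m ∈ range n, Q h x * (E m).indicator (fun _ => (1 : ℝ≥0∞)) (u h x) ∂μ :=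
        sum_le_sum fun h _ => sum_lintegral_le_lintegral_sum _ _
    _ ≤ ∑ h ∈ P, ∫⁻ x, Q h x ∂μ := by
        refine sum_le_sum fun h _ => lintegral_mono fun x => ?_
        rw [← mul_sum]
        calc Q h x * ∑ m ∈ range n, (E m).indicator (fun _ => (1 : ℝ≥0∞)) (u h x) ≤ Q h x * 1 :=
              mul_le_mul' le_rfl (hE (u h x))
          _ = Q h x := mul_one _
    _ ≤ ∫⁻ x, ∑ h ∈ P, Q h x ∂μ := sum_lintegral_le_lintegral_sum _ _
    _ ≤ ∫⁻ _x, (1 : ℝ≥0∞) ∂μ := lintegral_mono fun x => hQ x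
    _ = μ Set.univ := lintegral_one

/-- … in the REAL-VALUED form of §7's hypotheses `hA`/`hB`: candidate weights `f m ≥ 0` dominated by the tree
expression sum to at most the total mass `(μ univ).toReal` (finite measure). [folklore] -/
theorem ownShell_hyp_of_tree {X : Type*} [MeasurableSpace X] (μ : Measure X) [IsFiniteMeasure μ] {H H' : Type*}
    (P : Finset H) (P' : Finset H') (Q : H → X → ℝ≥0∞) (hQ : ∀ x, ∑ h ∈ P, Q h x ≤ 1) {n : ℕ}
    (R : H → H' → ℕ → X → ℝ≥0∞) (hR : ∀ h ∈ P, ∀ m ∈ range n, ∀ x, ∑ h' ∈ P', R h h' m x ≤ 1)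
    (u : H → X → ℝ) (E : ℕ → Set ℝ) (hE : ∀ y, ∑ m ∈ range n, (E m).indicator (fun _ => (1 : ℝ≥0∞)) y ≤ 1)
    (tested : Finset H) (ht : tested ⊆ P) (f : ℕ → ℝ) (hf0 : ∀ m, 0 ≤ f m)
    (hf : ∀ m ∈ range n, ENNReal.ofReal (f m) ≤ ∑ h ∈ tested, ∑ h' ∈ P',
        ∫⁻ x, Q h x * R h h' m x * (E m).indicator (fun _ => (1 : ℝ≥0∞)) (u h x) ∂μ) :
    ∑ m ∈ range n, f m ≤ (μ Set.univ).toReal := by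
  have h1 : ENNReal.ofReal (∑ m ∈ range n, f m) ≤ μ Set.univ := by
    rw [ENNReal.ofReal_sum_of_nonneg fun m _ => hf0 m]
    exact (sum_le_sum hf).trans (tree_ownShell_sum_le μ P P' Q hQ R hR u E hE tested ht)
  exact (ENNReal.ofReal_le_iff_le_toReal (measure_ne_top μ _)).mp h1

/-! ### measure wrapper for pointwise counts, pigeonhole from totals, the choice function -/

/-- a POINTWISE bound on the candidate-summed count integrates: `Σ_i ∫ N_i ≤ V·μ(univ)`. [folklore] -/
theorem sum_lintegral_le_of_pointwise {X : Type*} [MeasurableSpace X] (μ : Measure X) {n : ℕ}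
    (N : ℕ → X → ℝ≥0∞) (V : ℝ≥0∞) (hN : ∀ x, ∑ i ∈ range n, N i x ≤ V) :
    ∑ i ∈ range n, ∫⁻ x, N i x ∂μ ≤ V * μ Set.univ :=
  calc ∑ i ∈ range n, ∫⁻ x, N i x ∂μ ≤ ∫⁻ x, ∑ i ∈ range n, N i x ∂μ := sum_lintegral_le_lintegral_sum _ _
    _ ≤ ∫⁻ _x, V ∂μ := lintegral_mono hN
    _ = V * μ Set.univ := lintegral_const V

/-- … in real-valued form (finite measure, `V` finite): `Σ_i (∫ N_i).toReal ≤ V·(μ univ).toReal`. [folklore] -/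
theorem sum_toReal_lintegral_le_of_pointwise {X : Type*} [MeasurableSpace X] (μ : Measure X) [IsFiniteMeasure μ]
    {n : ℕ} (N : ℕ → X → ℝ≥0∞) (V : ℝ≥0) (hN : ∀ x, ∑ i ∈ range n, N i x ≤ V) :
    ∑ i ∈ range n, (∫⁻ x, N i x ∂μ).toReal ≤ V * (μ Set.univ).toReal := by
  have hfin : ∀ i ∈ range n, ∫⁻ x, N i x ∂μ ≠ ⊤ := by
    intro i hi
    have hle : ∫⁻ x, N i x ∂μ ≤ (V : ℝ≥0∞) * μ Set.univ :=
      calc ∫⁻ x, N i x ∂μ ≤ ∫⁻ _x, (V : ℝ≥0∞) ∂μ :=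
            lintegral_mono fun x => (single_le_sum (fun j _ => zero_le) hi).trans (hN x)
        _ = V * μ Set.univ := lintegral_const _
    exact ne_top_of_le_ne_top (ENNReal.mul_ne_top ENNReal.coe_ne_top (measure_ne_top μ Set.univ)) hle
  rw [← ENNReal.toReal_sum hfin]
  have h := ENNReal.toReal_mono (ENNReal.mul_ne_top ENNReal.coe_ne_top (measure_ne_top μ _))
    (sum_lintegral_le_of_pointwise μ N V hN)
  rwa [ENNReal.toReal_mul, ENNReal.coe_toReal] at h

/-- **THE TWO-RUN PIGEONHOLE FROM TOTALS**: candidate-summed shell totals `≤ V_A·Z_A`, `≤ V_B·Z_B` give a common index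
with both runs' shell totals `≤ ((V_A + V_B)/n) ×` their total weights. [folklore] -/
theorem exists_common_index_of_totals {n : ℕ} (hn : 0 < n) (FA FB : ℕ → ℝ) {ZA ZB VA VB : ℝ}
    (hZA : 0 < ZA) (hZB : 0 < ZB) (hA0 : ∀ i, 0 ≤ FA i) (hB0 : ∀ i, 0 ≤ FB i)
    (hA : ∑ i ∈ range n, FA i ≤ VA * ZA) (hB : ∑ i ∈ range n, FB i ≤ VB * ZB) :
    ∃ i ∈ range n, FA i ≤ ((VA + VB) / n) * ZA ∧ FB i ≤ ((VA + VB) / n) * ZB := by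
  set g : ℕ → ℝ := fun i => FA i / ZA + FB i / ZB with hg
  have hsum : ∑ i ∈ range n, g i ≤ VA + VB := by
    have h1 : ∑ i ∈ range n, FA i / ZA ≤ VA := by
      rw [← sum_div, div_le_iff₀ hZA]; exact hA
    have h2 : ∑ i ∈ range n, FB i / ZB ≤ VB := by
      rw [← sum_div, div_le_iff₀ hZB]; exact hB
    simp only [hg, sum_add_distrib]
    linarith
  obtain ⟨i, hi, hgi⟩ := exists_threshold_shell_le hn hsum
  have hAi : 0 ≤ FA i / ZA := div_nonneg (hA0 i) hZA.le
  have hBi : 0 ≤ FB i / ZB := div_nonneg (hB0 i) hZB.le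
  refine ⟨i, hi, ?_, ?_⟩
  · have : FA i / ZA ≤ (VA + VB) / n := by simp only [hg] at hgi; linarith
    rwa [div_le_iff₀ hZA] at this
  · have : FB i / ZB ≤ (VA + VB) / n := by simp only [hg] at hgi; linarith
    rwa [div_le_iff₀ hZB] at this

/-- **THE CHOICE FUNCTION OF THE LIVE COMMON FACTOR.**  Per number of steps `K`: `n K ≥ 1` candidate factors, both
runs' candidate-summed shell totals `≤ V·Z` (the cascade count, `V = 2(∏_σ (ν_σ + 1) − 1)`), and the candidate-count
rate `2/n K ≤ M·ϑ^K` (`candidateCount_spec` with `ρ⋆_K ≤ 2c₁ϑ^{K − N₁}`).  Then ONE factor index `i⋆ K < n K` per `K` makes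
both runs' realized shell totals `≤ (V·M)·ϑ^K ×` their total weights — the inputs `hqA`/`hqB` of
`shellWeightBound_of_realized`. [folklore] -/
theorem exists_liveFactor_choice_function (n : ℕ → ℕ) (hn : ∀ K, 0 < n K) (FA FB : ℕ → ℕ → ℝ) (ZA ZB : ℕ → ℝ)
    (hZA : ∀ K, 0 < ZA K) (hZB : ∀ K, 0 < ZB K) (hA0 : ∀ K i, 0 ≤ FA K i) (hB0 : ∀ K i, 0 ≤ FB K i)
    {V : ℝ} (hV : 0 ≤ V) (hA : ∀ K, ∑ i ∈ range (n K), FA K i ≤ V * ZA K)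
    (hB : ∀ K, ∑ i ∈ range (n K), FB K i ≤ V * ZB K)
    {M ϑ : ℝ} (hrate : ∀ K, (2 : ℝ) / n K ≤ M * ϑ ^ K) :
    ∃ istar : ℕ → ℕ, ∀ K, istar K < n K ∧
      FA K (istar K) ≤ ((V * M) * ϑ ^ K) * ZA K ∧ FB K (istar K) ≤ ((V * M) * ϑ ^ K) * ZB K := by
  have hK : ∀ K, ∃ i, i < n K ∧
      FA K i ≤ ((V * M) * ϑ ^ K) * ZA K ∧ FB K i ≤ ((V * M) * ϑ ^ K) * ZB K := by
    intro K
    obtain ⟨i, hi, hAi, hBi⟩ := exists_common_index_of_totals (hn K) (FA K) (FB K) (hZA K) (hZB K) (hA0 K)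
      (hB0 K) (hA K) (hB K)
    have hq : (V + V) / n K ≤ (V * M) * ϑ ^ K := by
      calc (V + V) / n K = V * (2 / n K) := by ring
        _ ≤ V * (M * ϑ ^ K) := mul_le_mul_of_nonneg_left (hrate K) hV
        _ = (V * M) * ϑ ^ K := by ring
    exact ⟨i, mem_range.mp hi, hAi.trans (mul_le_mul_of_nonneg_right hq (hZA K).le),
      hBi.trans (mul_le_mul_of_nonneg_right hq (hZB K).le)⟩
  exact ⟨fun K => (hK K).choose, fun K => (hK K).choose_spec⟩


/-! ### bridge: the ℕ-valued cascade count as the pointwise hypothesis of the measure wrapper -/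

/-- the pointwise hypothesis `hN` of `sum_lintegral_le_of_pointwise` from the cascade count: if at every configuration
`x` the hit count `N i x` is dominated by the hits of the live stages along the realized paths, then
`Σ_i N i x ≤ ∏_σ (ν_σ + 1) − 1`. [folklore] -/
theorem sum_le_cascade_of_hits {X α τ : Type*} [DecidableEq α] (st : X → ℕ → LiveStage α τ) (a₀ : X → α)
    (ν : ℕ → ℕ) (hν : ∀ x σ a, ((st x σ).tests a).card ≤ ν σ) (S n : ℕ) (N : ℕ → X → ℝ≥0∞)
    (hN : ∀ x, ∀ i ∈ range n, N i x ≤ ((∑ σ ∈ range S, (st x σ).hits (livePaths (st x) (a₀ x) σ) i : ℕ) : ℝ≥0∞)) :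
    ∀ x, ∑ i ∈ range n, N i x ≤ ((∏ σ ∈ range S, (ν σ + 1) - 1 : ℕ) : ℝ≥0∞) := by
  intro x
  have h := sum_hits_livePaths_le (st x) (a₀ x) n ν (hν x) S
  calc ∑ i ∈ range n, N i x
      ≤ ∑ i ∈ range n, ((∑ σ ∈ range S, (st x σ).hits (livePaths (st x) (a₀ x) σ) i : ℕ) : ℝ≥0∞) :=
        sum_le_sum (hN x)
    _ = ((∑ σ ∈ range S, ∑ i ∈ range n, (st x σ).hits (livePaths (st x) (a₀ x) σ) i : ℕ) : ℝ≥0∞) := by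
        rw [← Nat.cast_sum, sum_comm]
    _ ≤ ((∏ σ ∈ range S, (ν σ + 1) - 1 : ℕ) : ℝ≥0∞) := by
        exact_mod_cast (by omega : ∑ σ ∈ range S, ∑ i ∈ range n, (st x σ).hits (livePaths (st x) (a₀ x) σ) i
          ≤ ∏ σ ∈ range S, (ν σ + 1) - 1)

/-- candidate shell totals dominated by integrated hit counts inherit the cascade bound: `Σ_i F i ≤ V·(μ univ).toReal`.
[folklore] -/
theorem candidateTotals_le_of_pointwise {X : Type*} [MeasurableSpace X] (μ : Measure X) [IsFiniteMeasure μ] {n : ℕ}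
    (F : ℕ → ℝ) (N : ℕ → X → ℝ≥0∞) (V : ℝ≥0) (hN : ∀ x, ∑ i ∈ range n, N i x ≤ V)
    (hF : ∀ i ∈ range n, F i ≤ (∫⁻ x, N i x ∂μ).toReal) :
    ∑ i ∈ range n, F i ≤ V * (μ Set.univ).toReal :=
  (sum_le_sum hF).trans (sum_toReal_lintegral_le_of_pointwise μ N V hN)

/-! ### the end-to-end constructor of the live-factor member -/

/-- **THE CONSTRUCTOR OF THE LIVE COMMON FACTOR MEMBER, END TO END.**  For every `K`: `n K ≥ 1` candidate factor
indices; for every candidate index `i` the two runs' expansions written with the common live factor `λ_i`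
(weights `A K i`, `B K i`, shell parts, slot pieces) form realized slot ledgers FOR EVERY CHOICE FUNCTION (the
robustness input (L1-step): the printed tilt / cover inequalities hold uniformly over the slack window); the
candidate-summed shell totals obey the cascade bound `≤ V·Z` with `Z ≤` every candidate expansion's total weight
(partition of unity); and the candidate-count rate `2/n K ≤ M·ϑ^K`.  Then ONE choice function `i⋆` realizes
`T4IndicatorShell.ShellWeightBound` for the two runs written with `λ_{i⋆ K}`, with `Wsh K ≤ 2e^{2a}(V·M)·ϑ^K`.
[folklore] -/
theorem shellWeightBound_of_liveFactor {ι σ σ' : Type*} {l₀ a ϑ V M : ℝ} {T : ℕ → Finset ι}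
    (n : ℕ → ℕ) (hn : ∀ K, 0 < n K)
    {A B shA shB : ℕ → ℕ → ℝ → ι → ℝ} {SA : ℕ → Finset σ} {SB : ℕ → Finset σ'}
    {pieceA : ℕ → ℕ → ℝ → σ → ι → ℝ} {pieceB : ℕ → ℕ → ℝ → σ' → ι → ℝ}
    (hA : ∀ c : ℕ → ℕ, SlotLedger l₀ T (fun K => A K (c K)) (fun K => shA K (c K)) SA (fun K => pieceA K (c K))
      (fun K s => Real.exp (2 * a) * ((∑ τ ∈ T K, pieceA K (c K) 0 s τ) / ∑ τ ∈ T K, A K (c K) 0 τ)))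
    (hB : ∀ c : ℕ → ℕ, SlotLedger l₀ T (fun K => B K (c K)) (fun K => shB K (c K)) SB (fun K => pieceB K (c K))
      (fun K s => Real.exp (2 * a) * ((∑ τ ∈ T K, pieceB K (c K) 0 s τ) / ∑ τ ∈ T K, B K (c K) 0 τ)))
    (hpA0 : ∀ K i, 0 ≤ ∑ s ∈ SA K, ∑ τ ∈ T K, pieceA K i 0 s τ)
    (hpB0 : ∀ K i, 0 ≤ ∑ s ∈ SB K, ∑ τ ∈ T K, pieceB K i 0 s τ)
    {ZA ZB : ℕ → ℝ} (hZA0 : ∀ K, 0 < ZA K) (hZB0 : ∀ K, 0 < ZB K)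
    (hZAle : ∀ K i, ZA K ≤ ∑ τ ∈ T K, A K i 0 τ) (hZBle : ∀ K i, ZB K ≤ ∑ τ ∈ T K, B K i 0 τ)
    (hV : 0 ≤ V)
    (htotA : ∀ K, ∑ i ∈ range (n K), ∑ s ∈ SA K, ∑ τ ∈ T K, pieceA K i 0 s τ ≤ V * ZA K)
    (htotB : ∀ K, ∑ i ∈ range (n K), ∑ s ∈ SB K, ∑ τ ∈ T K, pieceB K i 0 s τ ≤ V * ZB K)
    (hrate : ∀ K, (2 : ℝ) / n K ≤ M * ϑ ^ K) (hϑ0 : 0 ≤ ϑ) (hϑ1 : ϑ < 1) :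
    ∃ istar : ℕ → ℕ, (∀ K, istar K < n K) ∧
      T4IndicatorShell.ShellWeightBound l₀ T (fun K => A K (istar K)) (fun K => B K (istar K))
        (fun K => shA K (istar K)) (fun K => shB K (istar K))
        (fun K => (hA istar).omega K + (hB istar).omega K) := by
  obtain ⟨istar, histar⟩ := exists_liveFactor_choice_function n hn
    (fun K i => ∑ s ∈ SA K, ∑ τ ∈ T K, pieceA K i 0 s τ) (fun K i => ∑ s ∈ SB K, ∑ τ ∈ T K, pieceB K i 0 s τ)
    ZA ZB hZA0 hZB0 hpA0 hpB0 hV htotA htotB hrate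
  have hCK : ∀ K, 0 ≤ (V * M) * ϑ ^ K := by
    intro K
    have h2 : 0 < (2 : ℝ) / n K := div_pos two_pos (Nat.cast_pos.mpr (hn K))
    have hMK : 0 ≤ M * ϑ ^ K := (h2.trans_le (hrate K)).le
    simpa only [mul_assoc] using mul_nonneg hV hMK
  have hZA : ∀ K, 0 < ∑ τ ∈ T K, A K (istar K) 0 τ := fun K => (hZA0 K).trans_le (hZAle K _)
  have hZB : ∀ K, 0 < ∑ τ ∈ T K, B K (istar K) 0 τ := fun K => (hZB0 K).trans_le (hZBle K _)
  refine ⟨istar, fun K => (histar K).1, shellWeightBound_of_realized (hA istar) (hB istar) hZA hZB hϑ0 hϑ1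
    (C := V * M) (fun K => ?_) (fun K => ?_)⟩
  · exact (histar K).2.1.trans (mul_le_mul_of_nonneg_left (hZAle K _) (hCK K))
  · exact (histar K).2.2.trans (mul_le_mul_of_nonneg_left (hZBle K _) (hCK K))

end Literature.MathematicalPhysics.QuantumFieldTheory.Balaban1983to89.T4ShellMeasure
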